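import Literature.NumberTheory.Sieve.ChenSwitchedSieve
import Literature.NumberTheory.Sieve.ChenBilinearForm
import Literature.NumberTheory.LFunctions.SiegelWalfisz
import HarnessLib

/-!
# Chen's theorem: the remainder of the switching term (Nathanson (10.15)) — PROVED

Topic `Literature/NumberTheory/Sieve`; sequel of `ChenSwitchedSieve.lean` (the sieve step of
Nathanson, *Additive Number Theory: The Classical Bases*, GTM 164, Thm 10.6, for
`B = {N − p₁p₂p₃}`). This file proves the second of the three steps of the proof of Theorem 10.6:
the remainder of the enlarged switched sequence at level `D = N^{1/2−δ}` is negligible,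

  `R(N, ε, N^{1/2−δ}) ≤ C(ε, δ) · N/(log N)³`  for all large `N`  (`switchedRemainderExt_le`),

Nathanson's (10.15) `R^{(ℓ)} ≪ N/(log N)⁴` summed over the `O(ε⁻¹ log N)` blocks `B^{(ℓ)}`
(pp. 289 and 293–295 of the book), from the bilinear form inequality Theorem 10.7 PROVED in
`ChenBilinearForm.lean` (`Bilinear.primes_explicit`: the large sieve for characters and the
Siegel–Walfisz theorem, both proved in the tree; the Siegel–Walfisz input enters through
`swBound_of_siegel_walfisz siegel_walfisz_holds`).

## The argument (Nathanson pp. 293–295) and its formal counterpart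

* The blocks. `T̃(N, ε)` (`switchedTriplesExt`) is the disjoint union over the grid index
  `k = k(p₁)` of `T_k = P_k × Q_k` (`switchedTriplesExt_filter_eq`), where
  `P_k = {p prime : ℓ_k ≤ p < min(y, (1+ε)ℓ_k), p ∤ N}` (`blockPrimes`; `k(p) = k ⟺
  ℓ_k ≤ p < (1+ε)ℓ_k`, `chenGridIndex_eq_iff`) and `Q_k = {(p₂, p₃) : y ≤ p₂ ≤ p₃,
  (p₂p₃, N) = 1, ℓ_k p₂p₃ < N}` (`blockPairs`), `ℓ_k = z(1+ε)^k` (`gridLevel`); the map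
  `(p₂, p₃) ↦ p₂p₃` is injective on `Q_k` (`mul_injOn_primePairs`), with image `M_k`
  (`blockProducts`). Hence `R(N, ε, D) ≤ ∑_k R^{(k)}` (`switchedRemainderExt_le_sum_blocks`).
* One block (p. 294). For `d ∣ P(y)` coprime to `N`,
  `#{t ∈ T_k : d ∣ |N − p₁p₂p₃|} = ∑_{m ∈ M_k} ∑_{p ∈ P_k} 1_{mp ≡ N (d)}`
  (`card_filter_dvd_tripleDist_eq`) — the bilinear count of Theorem 10.7 with `a = 1_{M_k}`,
  `X = N/ℓ_k`, `Y = min(y, (1+ε)ℓ_k)`, `Z = ℓ_k`, `K = N` — and "we delete some numbers from the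
  second sum by adding the condition `(p₁p₂p₃, d) = 1` … at most `ω(d) #M_k/φ(d)`"
  (`abs_blockRemainder_le`); for `d` not coprime to `N` count and density vanish
  (`card_filter_dvd_tripleDist_eq_zero`). Summing over `d` (`blockRemainder_sum_le`) and inserting
  `Bilinear.primes_explicit` with `D₀ = ⌊(log N/16)⁶⌋`, Siegel–Walfisz exponent `20`
  (`blockTotal_le`, the bookkeeping `blockBound_arith`: every term is `≪ N/(log N)⁴`, the critical
  one being `XY(log)²/D₀`, cf. Nathanson's `XY(log XY)²/(log Y)^A` with `A = 6`).
* The number of blocks is `K(N, ε) + 1 ≤ (1/log(1+ε) + 1) log N` (`maxGridIndex_add_one_le`).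

## References

* M. B. Nathanson, *Additive Number Theory: The Classical Bases*, GTM 164 (1996), Thm 10.6
  (proof, (10.12)–(10.15)) and Thm 10.7 with its application, pp. 289–295. [Nathanson1996]
-/

open Finset Filter Topology

noncomputable section

namespace Literature.NumberTheory.Sieve.Chen

open SieveSequence

/-! ### The grid levels `ℓ_k` and the blocks of `T̃(N, ε)` -/

/-- The grid level `ℓ_k = z(1+ε)^k`, `z = N^{1/8}` (Nathanson (10.12)). [cite: Nathanson1996, Thm 10.6 (proof, (10.12))] -/
def gridLevel (N : ℕ) (ε : ℝ) (k : ℕ) : ℝ := z N * (1 + ε) ^ k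

/-- `ℓ(p) = ℓ_{k(p)}`. [folklore] -/
theorem chenGridPoint_eq_gridLevel (N : ℕ) (ε : ℝ) (p : ℕ) :
    chenGridPoint N ε p = gridLevel N ε (chenGridIndex N ε p) := rfl

/-- `ℓ_k > 0` for `N ≥ 1`, `ε > 0`; and `z ≤ ℓ_k`. [folklore] -/
theorem gridLevel_pos {N : ℕ} {ε : ℝ} (hN : 0 < N) (hε : 0 < ε) (k : ℕ) :
    0 < gridLevel N ε k ∧ z N ≤ gridLevel N ε k := by
  have hz : 0 < z N := Real.rpow_pos_of_pos (by exact_mod_cast hN) _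
  refine ⟨mul_pos hz (pow_pos (by linarith) _), ?_⟩
  exact le_mul_of_one_le_right hz.le (one_le_pow₀ (by linarith))

/-- **The grid index is the block label**: for `p ≥ z`, `k(p) = k ⟺ ℓ_k ≤ p < (1+ε)ℓ_k`.
[cite: Nathanson1996, Thm 10.6 (proof, (10.12))] -/
theorem chenGridIndex_eq_iff {N : ℕ} {ε : ℝ} (hN : 0 < N) (hε : 0 < ε) {p : ℕ}
    (hp : z N ≤ (p : ℝ)) (k : ℕ) :
    chenGridIndex N ε p = k ↔ gridLevel N ε k ≤ p ∧ (p : ℝ) < (1 + ε) * gridLevel N ε k := by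
  have hz : 0 < z N := Real.rpow_pos_of_pos (by exact_mod_cast hN) _
  have hp0 : (0 : ℝ) < p := hz.trans_le hp
  have hlog1 : 0 < Real.log (1 + ε) := Real.log_pos (by linarith)
  set q : ℝ := Real.log ((p : ℝ) / z N) / Real.log (1 + ε) with hq
  have hq0 : 0 ≤ q := div_nonneg (Real.log_nonneg (by rwa [le_div_iff₀ hz, one_mul])) hlog1.le
  have hidx : chenGridIndex N ε p = ⌊q⌋₊ := rfl
  -- `(1+ε)^k ≤ p/z ⟺ k ≤ q`, and `p/z < (1+ε)^{k+1} ⟺ q < k + 1`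
  have hpow : ∀ m : ℕ, ((1 + ε) ^ m ≤ (p : ℝ) / z N ↔ (m : ℝ) ≤ q) ∧
      ((p : ℝ) / z N < (1 + ε) ^ m ↔ q < m) := by
    intro m
    have e : (1 + ε) ^ m = Real.exp (Real.log (1 + ε) * m) := by
      rw [← Real.rpow_natCast, Real.rpow_def_of_pos (by linarith)]
    have e2 : (p : ℝ) / z N = Real.exp (Real.log (1 + ε) * q) := by
      rw [hq, mul_div_cancel₀ _ hlog1.ne', Real.exp_log (div_pos hp0 hz)]
    rw [e, e2, Real.exp_le_exp, Real.exp_lt_exp]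
    exact ⟨mul_le_mul_iff_right₀ hlog1, mul_lt_mul_iff_right₀ hlog1⟩
  rw [hidx, gridLevel]
  constructor
  · intro hk
    subst hk
    constructor
    · have h1 : (1 + ε) ^ ⌊q⌋₊ ≤ (p : ℝ) / z N := (hpow _).1.mpr (Nat.floor_le hq0)
      rw [le_div_iff₀ hz] at h1
      linarith [h1]
    · have h1 : (p : ℝ) / z N < (1 + ε) ^ (⌊q⌋₊ + 1) :=
        (hpow _).2.mpr (by push_cast; exact Nat.lt_floor_add_one q)
      rw [div_lt_iff₀ hz] at h1
      calc (p : ℝ) < (1 + ε) ^ (⌊q⌋₊ + 1) * z N := h1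
        _ = (1 + ε) * (z N * (1 + ε) ^ ⌊q⌋₊) := by ring
  · rintro ⟨h1, h2⟩
    have h1' : (k : ℝ) ≤ q := by
      refine (hpow k).1.mp ?_
      rw [le_div_iff₀ hz]; linarith
    have h2' : q < (k : ℝ) + 1 := by
      have := (hpow (k + 1)).2.mp (by
        rw [div_lt_iff₀ hz]
        calc (p : ℝ) < (1 + ε) * (z N * (1 + ε) ^ k) := h2
          _ = (1 + ε) ^ (k + 1) * z N := by ring)
      exact_mod_cast this
    exact (Nat.floor_eq_iff hq0).mpr ⟨h1', h2'⟩

/-- The prime variable of block `k`: `P_k = {p prime : ℓ_k ≤ p < min(y, (1+ε)ℓ_k), p ∤ N}`, in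
the shape of `Bilinear.primes_explicit` (`TY = ⌈min(y, (1+ε)ℓ_k)⌉`, `TZ = ⌈ℓ_k⌉`, `K = N`).
[cite: Nathanson1996, Thm 10.6 (proof, (10.13))] -/
def blockPrimes (N : ℕ) (ε : ℝ) (k : ℕ) : Finset ℕ :=
  (Nat.primesBelow ⌈min (y N) ((1 + ε) * gridLevel N ε k)⌉₊).filter
    fun p => ⌈gridLevel N ε k⌉₊ ≤ p ∧ ¬p ∣ N

/-- Membership in `P_k`. [folklore] -/
theorem mem_blockPrimes {N : ℕ} {ε : ℝ} {k p : ℕ} :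
    p ∈ blockPrimes N ε k ↔ p.Prime ∧ gridLevel N ε k ≤ p ∧ (p : ℝ) < y N ∧
      (p : ℝ) < (1 + ε) * gridLevel N ε k ∧ ¬p ∣ N := by
  rw [blockPrimes, Finset.mem_filter, Nat.mem_primesBelow, Nat.lt_ceil, lt_min_iff, Nat.ceil_le]
  tauto

/-- The pairs of block `k`: `Q_k = {(p₂, p₃) : y ≤ p₂ ≤ p₃ < N primes, (p₂p₃, N) = 1, ℓ_k p₂p₃ < N}`.
[cite: Nathanson1996, Thm 10.6 (proof, (10.13))] -/
def blockPairs (N : ℕ) (ε : ℝ) (k : ℕ) : Finset (ℕ × ℕ) :=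
  (Finset.range N ×ˢ Finset.range N).filter fun q : ℕ × ℕ =>
    q.1.Prime ∧ q.2.Prime ∧ y N ≤ (q.1 : ℝ) ∧ q.1 ≤ q.2 ∧ (q.1 * q.2).Coprime N ∧
      gridLevel N ε k * q.1 * q.2 < (N : ℝ)

/-- Membership in `Q_k`. [folklore] -/
theorem mem_blockPairs {N : ℕ} {ε : ℝ} {k : ℕ} {q : ℕ × ℕ} :
    q ∈ blockPairs N ε k ↔ (q.1 < N ∧ q.2 < N) ∧ q.1.Prime ∧ q.2.Prime ∧ y N ≤ (q.1 : ℝ) ∧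
      q.1 ≤ q.2 ∧ (q.1 * q.2).Coprime N ∧ gridLevel N ε k * q.1 * q.2 < (N : ℝ) := by
  simp only [blockPairs, Finset.mem_filter, Finset.mem_product, Finset.mem_range]

/-- The `n`-variable of block `k`: `M_k = {p₂p₃ : (p₂, p₃) ∈ Q_k}`. [cite: Nathanson1996, Thm 10.6 (proof, (10.15))] -/
def blockProducts (N : ℕ) (ε : ℝ) (k : ℕ) : Finset ℕ :=
  (blockPairs N ε k).image fun q : ℕ × ℕ => q.1 * q.2

/-- `(p₂, p₃) ↦ p₂p₃` is injective on ordered pairs of primes. [folklore] -/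
theorem mul_injOn_primePairs (S : Finset (ℕ × ℕ))
    (hS : ∀ q ∈ S, q.1.Prime ∧ q.2.Prime ∧ q.1 ≤ q.2) :
    Set.InjOn (fun q : ℕ × ℕ => q.1 * q.2) S := by
  intro q hq q' hq' h
  obtain ⟨h1, h2, h12⟩ := hS q hq
  obtain ⟨h1', h2', h12'⟩ := hS q' hq'
  dsimp only at h
  have hdvd : q.1 ∣ q'.1 * q'.2 := ⟨q.2, h.symm⟩
  rcases (Nat.Prime.dvd_mul h1).mp hdvd with hd | hd
  · have he : q.1 = q'.1 := (Nat.prime_dvd_prime_iff_eq h1 h1').mp hd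
    have he2 : q.2 = q'.2 := by
      rw [he] at h
      exact Nat.eq_of_mul_eq_mul_left h1'.pos h
    exact Prod.ext he he2
  · have he : q.1 = q'.2 := (Nat.prime_dvd_prime_iff_eq h1 h2').mp hd
    have he2 : q.2 = q'.1 := by
      rw [he, mul_comm q'.1] at h
      exact Nat.eq_of_mul_eq_mul_left h2'.pos h
    have : q.1 = q.2 := le_antisymm h12 (by rw [he, he2]; exact h12')
    refine Prod.ext ?_ ?_
    · -- `q.1 = q'.1`
      rw [this, he2]
    · -- `q.2 = q'.2`
      rw [← this, he]

/-- `#M_k = #Q_k`. [folklore] -/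
theorem card_blockProducts (N : ℕ) (ε : ℝ) (k : ℕ) :
    #(blockProducts N ε k) = #(blockPairs N ε k) := by
  unfold blockProducts
  refine Finset.card_image_of_injOn (mul_injOn_primePairs _ fun q hq => ?_)
  obtain ⟨-, h1, h2, -, h12, -⟩ := mem_blockPairs.mp hq
  exact ⟨h1, h2, h12⟩

/-- Counting over `Q_k` through `M_k`: `#{q ∈ Q_k : P(p₂p₃)} = #{m ∈ M_k : P(m)}`. [folklore] -/
theorem card_filter_blockPairs_eq (N : ℕ) (ε : ℝ) (k : ℕ) (P : ℕ → Prop) [DecidablePred P] :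
    #((blockPairs N ε k).filter fun q : ℕ × ℕ => P (q.1 * q.2)) =
      #((blockProducts N ε k).filter P) := by
  classical
  unfold blockProducts
  rw [Finset.filter_image, Finset.card_image_of_injOn]
  refine mul_injOn_primePairs _ fun q hq => ?_
  obtain ⟨-, h1, h2, -, h12, -⟩ := mem_blockPairs.mp (Finset.mem_filter.mp hq).1
  exact ⟨h1, h2, h12⟩

/-- Elements of `M_k`: `m = p₂p₃` with `y² ≤ m`, `ℓ_k m < N`, `(m, N) = 1`, and `m` has no prime
factor `< y`. [folklore] -/
theorem mem_blockProducts {N : ℕ} {ε : ℝ} {k m : ℕ} (hm : m ∈ blockProducts N ε k) :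
    ∃ q ∈ blockPairs N ε k, q.1 * q.2 = m := by
  unfold blockProducts at hm
  simpa only [Finset.mem_image] using hm

/-- **The blocks are products**: `T_k = {t ∈ T̃ : k(p₁) = k} = P_k × Q_k` (as sets of
`ℕ × (ℕ × ℕ)`), for `N ≥ 2`, `0 < ε`. [cite: Nathanson1996, Thm 10.6 (proof, (10.13))] -/
theorem switchedTriplesExt_filter_eq {N : ℕ} {ε : ℝ} (hN : 2 ≤ N) (hε : 0 < ε) (k : ℕ) :
    (switchedTriplesExt N ε).filter (fun t : ℕ × ℕ × ℕ => chenGridIndex N ε t.1 = k) =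
      blockPrimes N ε k ×ˢ blockPairs N ε k := by
  have hNpos : 0 < N := by omega
  have hN1 : (1 : ℝ) < N := by exact_mod_cast (show 1 < N by omega)
  obtain ⟨hℓ0, hzℓ⟩ := gridLevel_pos hNpos hε k
  have hz1 : 1 ≤ z N := Real.one_le_rpow hN1.le (by norm_num)
  have hyN : y N < N := by
    have : y N < (N : ℝ) ^ (1 : ℝ) := Real.rpow_lt_rpow_of_exponent_lt hN1 (by norm_num)
    rwa [Real.rpow_one] at this
  ext t
  rw [Finset.mem_filter, mem_switchedTriplesExt, Finset.mem_product, mem_blockPrimes, mem_blockPairs]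
  constructor
  · rintro ⟨⟨⟨-, h2N, h3N⟩, h₁, h₂, h₃, hz, hy, hy', h23, hndvd, hcop, hlt⟩, hk⟩
    obtain ⟨hℓp, hpℓ⟩ := (chenGridIndex_eq_iff hNpos hε hz k).mp hk
    rw [chenGridPoint_eq_gridLevel, hk] at hlt
    exact ⟨⟨h₁, hℓp, hy, hpℓ, hndvd⟩, ⟨h2N, h3N⟩, h₂, h₃, hy', h23, hcop, hlt⟩
  · rintro ⟨⟨h₁, hℓp, hy, hpℓ, hndvd⟩, ⟨h2N, h3N⟩, h₂, h₃, hy', h23, hcop, hlt⟩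
    have hz : z N ≤ (t.1 : ℝ) := hzℓ.trans hℓp
    have hk : chenGridIndex N ε t.1 = k := (chenGridIndex_eq_iff hNpos hε hz k).mpr ⟨hℓp, hpℓ⟩
    have h1N : t.1 < N := by exact_mod_cast hy.trans hyN
    refine ⟨⟨⟨h1N, h2N, h3N⟩, h₁, h₂, h₃, hz, hy, hy', h23, hndvd, hcop, ?_⟩, hk⟩
    rw [chenGridPoint_eq_gridLevel, hk]
    exact hlt


/-! ### Counting in a block: the bilinear shape of `r_d^{(k)}` -/

/-- Elements of `M_k` are `≥ 1`, `< N/ℓ_k`, coprime to `N`, and coprime to every `d ∣ P(y)` (their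
prime factors are `≥ y`). [folklore] -/
theorem blockProducts_props {N : ℕ} {ε : ℝ} (hN : 0 < N) (hε : 0 < ε) {k m : ℕ}
    (hm : m ∈ blockProducts N ε k) :
    1 ≤ m ∧ (m : ℝ) < N / gridLevel N ε k ∧ m.Coprime N ∧
      ∀ d : ℕ, d ∣ primesProdBelow (y N) → m.Coprime d := by
  obtain ⟨q, hq, rfl⟩ := mem_blockProducts hm
  obtain ⟨-, h1, h2, hy1, h12, hcop, hlt⟩ := mem_blockPairs.mp hq
  obtain ⟨hℓ0, -⟩ := gridLevel_pos hN hε k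
  refine ⟨Nat.one_le_iff_ne_zero.mpr (Nat.mul_ne_zero h1.ne_zero h2.ne_zero), ?_, hcop, ?_⟩
  · rw [lt_div_iff₀ hℓ0]
    calc ((q.1 * q.2 : ℕ) : ℝ) * gridLevel N ε k = gridLevel N ε k * q.1 * q.2 := by push_cast; ring
      _ < N := hlt
  · intro d hd
    rw [Nat.coprime_mul_iff_left]
    have key : ∀ r : ℕ, r.Prime → y N ≤ (r : ℝ) → r.Coprime d := by
      intro r hr hyr
      rw [Nat.Prime.coprime_iff_not_dvd hr]
      intro hrd
      have hrP : r ∣ primesProdBelow (y N) := hrd.trans hd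
      rw [dvd_primesProdBelow_iff hr] at hrP
      linarith
    have hy2 : y N ≤ (q.2 : ℝ) := hy1.trans (by exact_mod_cast h12)
    exact ⟨key q.1 h1 hy1, key q.2 h2 hy2⟩

/-- The prime variable `P_k` consists of primes not dividing `N`. [folklore] -/
theorem prime_of_mem_blockPrimes {N : ℕ} {ε : ℝ} {k p : ℕ} (hp : p ∈ blockPrimes N ε k) :
    p.Prime ∧ ¬p ∣ N :=
  ⟨(mem_blockPrimes.mp hp).1, (mem_blockPrimes.mp hp).2.2.2.2⟩

/-- **The congruence count of a block is bilinear**: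
`#{(p, q) ∈ P_k × Q_k : d ∣ |N − p p₂p₃|} = ∑_{m ∈ M_k} ∑_{p ∈ P_k} 1_{mp ≡ N (d)}`.
[cite: Nathanson1996, Thm 10.6 (proof, (10.15))] -/
theorem card_filter_dvd_tripleDist_eq (N : ℕ) (ε : ℝ) (k d : ℕ) :
    (#((blockPrimes N ε k ×ˢ blockPairs N ε k).filter fun t : ℕ × ℕ × ℕ => d ∣ tripleDist N t) : ℕ) =
      ∑ m ∈ blockProducts N ε k, ∑ p ∈ blockPrimes N ε k,
        if ((m * p : ℕ) : ZMod d) = (N : ZMod d) then 1 else 0 := by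
  classical
  rw [Finset.card_filter, Finset.sum_product]
  -- rewrite the inner sums through `M_k`
  have hinner : ∀ p ∈ blockPrimes N ε k,
      ∑ q ∈ blockPairs N ε k, (if d ∣ tripleDist N (p, q) then 1 else 0) =
        ∑ m ∈ blockProducts N ε k, if ((m * p : ℕ) : ZMod d) = (N : ZMod d) then 1 else 0 := by
    intro p _
    rw [← Finset.card_filter, ← Finset.card_filter]
    have h1 : (blockPairs N ε k).filter (fun q : ℕ × ℕ => d ∣ tripleDist N (p, q)) =
        (blockPairs N ε k).filter (fun q : ℕ × ℕ =>
          ((q.1 * q.2 * p : ℕ) : ZMod d) = (N : ZMod d)) := by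
      refine Finset.filter_congr fun q _ => ?_
      rw [dvd_tripleDist_iff]
      dsimp only
      rw [show p * q.1 * q.2 = q.1 * q.2 * p by ring]
    rw [h1]
    exact card_filter_blockPairs_eq N ε k (fun m => ((m * p : ℕ) : ZMod d) = (N : ZMod d))
  rw [Finset.sum_congr rfl hinner]
  exact Finset.sum_comm

/-- The same count in the shape of `Bilinear.primes_explicit` (indicator coefficients `a = 1_{M_k}`
over `n ∈ [1, M]`, `M_k ⊆ [1, M]`, residue `c = N`). [folklore] -/
theorem sum_Ioc_indicator_blockProducts_eq {N : ℕ} {ε : ℝ} {k M : ℕ}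
    (hM : blockProducts N ε k ⊆ Finset.Ioc 0 M) (P : ℕ → ℕ → Prop) [∀ n p, Decidable (P n p)] :
    ∑ n ∈ Finset.Ioc 0 M, ∑ p ∈ blockPrimes N ε k,
        (if P n p then (if n ∈ blockProducts N ε k then (1 : ℂ) else 0) else 0) =
      ((∑ m ∈ blockProducts N ε k, ∑ p ∈ blockPrimes N ε k, if P m p then 1 else 0 : ℕ) : ℂ) := by
  classical
  push_cast
  have hstep : ∀ n, ∑ p ∈ blockPrimes N ε k,
      (if P n p then (if n ∈ blockProducts N ε k then (1 : ℂ) else 0) else 0) =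
        if n ∈ blockProducts N ε k then ∑ p ∈ blockPrimes N ε k, (if P n p then (1 : ℂ) else 0)
          else 0 := by
    intro n
    by_cases hn : n ∈ blockProducts N ε k
    · simp only [hn, if_true]
    · simp only [hn, if_false]
      exact Finset.sum_eq_zero fun p _ => by split_ifs <;> rfl
  simp_rw [hstep]
  rw [Finset.sum_ite_mem, Finset.inter_eq_right.mpr hM]

/-- The unit `N mod d` for `(d, N) = 1`. [folklore] -/
def resClass (N d : ℕ) (h : d.Coprime N) : (ZMod d)ˣ := ZMod.unitOfCoprime N h.symm

/-- `↑(resClass N d h) = N`. [folklore] -/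
theorem coe_resClass (N d : ℕ) (h : d.Coprime N) : ((resClass N d h : (ZMod d)ˣ) : ZMod d) = N :=
  ZMod.coe_unitOfCoprime N h.symm

/-- **The remainder of a block against the bilinear discrepancy** (Nathanson p. 294: "We delete some
numbers from the second sum by adding the condition that `(p₁p₂p₃, d) = 1` … This additional
condition decreases the second term by at most `(1+ε)Nω(d)/(zφ(d))`"): for `d ∣ P(y)` coprime to
`N`,
`|#{t ∈ P_k × Q_k : d ∣ |N − p₁p₂p₃|} − #P_k #M_k/φ(d)|
  ≤ ‖∑_{mp ≡ N} 1_{M_k}(m) − φ(d)⁻¹ ∑_{(mp,d)=1} 1_{M_k}(m)‖ + ω(d) #M_k/φ(d)`.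
[cite: Nathanson1996, Thm 10.6 (proof, p. 294)] -/
theorem abs_blockRemainder_le {N : ℕ} {ε : ℝ} (hN : 0 < N) (hε : 0 < ε) (k : ℕ) {d : ℕ}
    (hd : d ∣ primesProdBelow (y N)) (hdN : d.Coprime N) {M : ℕ}
    (hM : blockProducts N ε k ⊆ Finset.Ioc 0 M) :
    |(#((blockPrimes N ε k ×ˢ blockPairs N ε k).filter
          fun t : ℕ × ℕ × ℕ => d ∣ tripleDist N t) : ℝ) -
        (#(blockPrimes N ε k) : ℝ) * #(blockProducts N ε k) / Nat.totient d| ≤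
      ‖(∑ n ∈ Finset.Ioc 0 M, ∑ p ∈ blockPrimes N ε k,
            if ((n * p : ℕ) : ZMod d) = (resClass N d hdN : (ZMod d)ˣ) then
              (if n ∈ blockProducts N ε k then (1 : ℂ) else 0) else 0) -
          ((Nat.totient d : ℂ))⁻¹ *
            ∑ n ∈ Finset.Ioc 0 M, ∑ p ∈ blockPrimes N ε k,
              (if (n * p).Coprime d then (if n ∈ blockProducts N ε k then (1 : ℂ) else 0) else 0)‖ +
        (d.primeFactors.card : ℝ) * #(blockProducts N ε k) / Nat.totient d := by
  classical
  have hd0 : d ≠ 0 := by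
    rintro rfl
    exact primesProdBelow_ne_zero _ (zero_dvd_iff.mp hd)
  have hφ : 0 < (Nat.totient d : ℝ) := by exact_mod_cast Nat.totient_pos.mpr (Nat.pos_of_ne_zero hd0)
  -- the three integer counts
  set S₁ : ℕ := ∑ m ∈ blockProducts N ε k, ∑ p ∈ blockPrimes N ε k, if ((m * p : ℕ) : ZMod d) = (N : ZMod d) then 1 else 0 with hS₁
  set S₂ : ℕ := ∑ m ∈ blockProducts N ε k, ∑ p ∈ blockPrimes N ε k, if (m * p).Coprime d then 1 else 0 with hS₂
  set S₃ : ℕ := ∑ m ∈ blockProducts N ε k, ∑ p ∈ blockPrimes N ε k, if ¬(m * p).Coprime d then 1 else 0 with hS₃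
  have hcount : (#((blockPrimes N ε k ×ˢ blockPairs N ε k).filter fun t : ℕ × ℕ × ℕ => d ∣ tripleDist N t) : ℕ) =
      S₁ := card_filter_dvd_tripleDist_eq N ε k d
  have h23 : S₂ + S₃ = #(blockPrimes N ε k) * #(blockProducts N ε k) := by
    rw [hS₂, hS₃, ← Finset.sum_add_distrib]
    have : ∀ m ∈ blockProducts N ε k, (∑ p ∈ blockPrimes N ε k, (if (m * p).Coprime d then 1 else 0) +
        ∑ p ∈ blockPrimes N ε k, if ¬(m * p).Coprime d then 1 else 0) = #(blockPrimes N ε k) := by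
      intro m _
      rw [← Finset.sum_add_distrib]
      calc ∑ p ∈ blockPrimes N ε k, ((if (m * p).Coprime d then 1 else 0) + if ¬(m * p).Coprime d then 1 else 0)
          = ∑ _p ∈ blockPrimes N ε k, 1 := Finset.sum_congr rfl fun p _ => by split_ifs <;> simp
        _ = #(blockPrimes N ε k) := by simp
    rw [Finset.sum_congr rfl this, Finset.sum_const, smul_eq_mul, mul_comm]
  -- `S₃ ≤ ω(d) #(blockProducts N ε k)`
  have h3 : S₃ ≤ d.primeFactors.card * #(blockProducts N ε k) := by
    rw [hS₃]
    calc ∑ m ∈ blockProducts N ε k, ∑ p ∈ blockPrimes N ε k, (if ¬(m * p).Coprime d then 1 else 0)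
        ≤ ∑ _m ∈ blockProducts N ε k, d.primeFactors.card := by
          refine Finset.sum_le_sum fun m hm => ?_
          obtain ⟨-, -, -, hcopd⟩ := blockProducts_props hN hε hm
          have hmd : m.Coprime d := hcopd d hd
          rw [← Finset.card_filter]
          refine Finset.card_le_card_of_injOn (fun p => p) (fun p hp => ?_) (Set.injOn_id _)
          rw [Finset.mem_coe, Finset.mem_filter] at hp
          obtain ⟨hpP, hncop⟩ := hp
          have hpprime := (prime_of_mem_blockPrimes hpP).1
          rw [Nat.coprime_mul_iff_left, not_and_or] at hncop
          rcases hncop with h | h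
          · exact absurd hmd h
          · rw [Finset.mem_coe, Nat.mem_primeFactors]
            exact ⟨hpprime, (Nat.Prime.dvd_iff_not_coprime hpprime).mpr h, hd0⟩
      _ = d.primeFactors.card * #(blockProducts N ε k) := by rw [Finset.sum_const, smul_eq_mul, mul_comm]
  -- the bilinear expression equals `S₁ - S₂/φ(d)`
  have hE : (∑ n ∈ Finset.Ioc 0 M, ∑ p ∈ blockPrimes N ε k,
        if ((n * p : ℕ) : ZMod d) = (resClass N d hdN : (ZMod d)ˣ) then
          (if n ∈ blockProducts N ε k then (1 : ℂ) else 0) else 0) -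
      ((Nat.totient d : ℂ))⁻¹ *
        ∑ n ∈ Finset.Ioc 0 M, ∑ p ∈ blockPrimes N ε k,
          (if (n * p).Coprime d then (if n ∈ blockProducts N ε k then (1 : ℂ) else 0) else 0) =
      ((S₁ : ℝ) - (S₂ : ℝ) / Nat.totient d : ℝ) := by
    rw [coe_resClass, sum_Ioc_indicator_blockProducts_eq hM, sum_Ioc_indicator_blockProducts_eq hM,
      hS₁, hS₂]
    push_cast
    simp only [apply_ite Complex.ofReal, Complex.ofReal_one, Complex.ofReal_zero]
    ring
  rw [hE, Complex.norm_real, Real.norm_eq_abs, hcount]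
  -- `|S₁ - #(blockPrimes N ε k) #(blockProducts N ε k)/φ| ≤ |S₁ - S₂/φ| + S₃/φ`
  have hkey : (S₁ : ℝ) - (#(blockPrimes N ε k) : ℝ) * #(blockProducts N ε k) / Nat.totient d =
      ((S₁ : ℝ) - (S₂ : ℝ) / Nat.totient d) - (S₃ : ℝ) / Nat.totient d := by
    have : ((#(blockPrimes N ε k) : ℝ)) * #(blockProducts N ε k) = (S₂ : ℝ) + S₃ := by exact_mod_cast h23.symm
    rw [this]; ring
  rw [hkey]
  have hS₃ : (S₃ : ℝ) / Nat.totient d ≤ (d.primeFactors.card : ℝ) * #(blockProducts N ε k) / Nat.totient d :=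
    div_le_div_of_nonneg_right (by exact_mod_cast h3) hφ.le
  have hS₃0 : 0 ≤ (S₃ : ℝ) / Nat.totient d := by positivity
  calc |((S₁ : ℝ) - (S₂ : ℝ) / Nat.totient d) - (S₃ : ℝ) / Nat.totient d|
      ≤ |(S₁ : ℝ) - (S₂ : ℝ) / Nat.totient d| + |(S₃ : ℝ) / Nat.totient d| := abs_sub _ _
    _ ≤ _ := by rw [abs_of_nonneg hS₃0]; exact add_le_add le_rfl hS₃

/-- For `d ∣ P(y)` NOT coprime to `N` the block count vanishes: a prime `q ∣ (d, N)` dividing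
`N − p₁p₂p₃` would divide `p₁p₂p₃`, but `q < y ≤ p₂ ≤ p₃` and `p₁ ∤ N`. [folklore] -/
theorem card_filter_dvd_tripleDist_eq_zero {N : ℕ} {ε : ℝ} (k : ℕ) {d : ℕ}
    (hd : d ∣ primesProdBelow (y N)) (hdN : ¬d.Coprime N) :
    #((blockPrimes N ε k ×ˢ blockPairs N ε k).filter
        fun t : ℕ × ℕ × ℕ => d ∣ tripleDist N t) = 0 := by
  rw [Finset.card_eq_zero, Finset.filter_eq_empty_iff]
  intro t ht hdt
  rw [Finset.mem_product] at ht
  obtain ⟨hp₁, hndvd⟩ := prime_of_mem_blockPrimes ht.1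
  obtain ⟨-, h₂, h₃, hy2, h23, -, -⟩ := mem_blockPairs.mp ht.2
  -- a prime `q ∣ gcd(d, N)`
  obtain ⟨q, hq, hqg⟩ := Nat.exists_prime_and_dvd (show Nat.gcd d N ≠ 1 from hdN)
  have hqd : q ∣ d := hqg.trans (Nat.gcd_dvd_left d N)
  have hqN : q ∣ N := hqg.trans (Nat.gcd_dvd_right d N)
  have hqy : (q : ℝ) < y N := by
    have hqP : q ∣ primesProdBelow (y N) := hqd.trans hd
    rwa [dvd_primesProdBelow_iff hq] at hqP
  -- `q ∣ N - p₁p₂p₃`, hence `q ∣ p₁p₂p₃`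
  have hqdist : (q : ℤ) ∣ (N : ℤ) - t.1 * t.2.1 * t.2.2 := by
    have : q ∣ tripleDist N t := hqd.trans hdt
    unfold tripleDist at this
    rwa [← Int.natCast_dvd_natCast, Int.natCast_natAbs, dvd_abs] at this
  have hqP : q ∣ t.1 * t.2.1 * t.2.2 := by
    have h1 : (q : ℤ) ∣ (t.1 * t.2.1 * t.2.2 : ℕ) := by
      have := dvd_sub (Int.natCast_dvd_natCast.mpr hqN) hqdist
      push_cast at this ⊢
      simpa using this
    exact Int.natCast_dvd_natCast.mp h1
  rcases (Nat.Prime.dvd_mul hq).mp hqP with h12 | h3'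
  · rcases (Nat.Prime.dvd_mul hq).mp h12 with h1' | h2'
    · exact hndvd ((Nat.prime_dvd_prime_iff_eq hq hp₁).mp h1' ▸ hqN)
    · have := (Nat.prime_dvd_prime_iff_eq hq h₂).mp h2'
      rw [this] at hqy
      linarith
  · have := (Nat.prime_dvd_prime_iff_eq hq h₃).mp h3'
    have hy3 : y N ≤ (t.2.2 : ℝ) := hy2.trans (by exact_mod_cast h23)
    rw [this] at hqy
    linarith


/-! ### Summing over the moduli `d` and over the blocks -/

open scoped Classical in
/-- **The remainder of one block** ((10.15) for `B^{(ℓ)}`): for `D ≥ 0`,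
`∑_{d < ⌈D⌉, d ∣ P(y)} |#{t ∈ P_k × Q_k : d ∣ |N − p₁p₂p₃|} − g(d) #P_k #Q_k|
  ≤ ∑_{d ≤ ⌈D⌉} max_c ‖E_k(d, c)‖ + ∑_{d ≤ ⌈D⌉} ω(d) #M_k/φ(d)`,
with `E_k` the bilinear discrepancy of `Bilinear.primes_explicit` for `a = 1_{M_k}`.
[cite: Nathanson1996, Thm 10.6 (proof, (10.15))] -/
theorem blockRemainder_sum_le {N : ℕ} {ε : ℝ} (hN : 0 < N) (hε : 0 < ε) (k : ℕ) (D : ℝ) {M : ℕ}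
    (hM : blockProducts N ε k ⊆ Finset.Ioc 0 M) :
    ∑ d ∈ (Finset.range ⌈D⌉₊).filter (· ∣ primesProdBelow (y N)),
        |(#((blockPrimes N ε k ×ˢ blockPairs N ε k).filter
            fun t : ℕ × ℕ × ℕ => d ∣ tripleDist N t) : ℝ) -
          shiftedPrimesDensity N d * #(blockPrimes N ε k ×ˢ blockPairs N ε k)| ≤
      ∑ d ∈ Finset.Icc 1 ⌈D⌉₊, (⨆ c : (ZMod d)ˣ,
        ‖(∑ n ∈ Finset.Ioc 0 M, ∑ p ∈ blockPrimes N ε k,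
            if ((n * p : ℕ) : ZMod d) = c then
              (if n ∈ blockProducts N ε k then (1 : ℂ) else 0) else 0) -
          ((Nat.totient d : ℂ))⁻¹ *
            ∑ n ∈ Finset.Ioc 0 M, ∑ p ∈ blockPrimes N ε k,
              (if (n * p).Coprime d then (if n ∈ blockProducts N ε k then (1 : ℂ) else 0) else 0)‖) +
      ∑ d ∈ Finset.Icc 1 ⌈D⌉₊,
        (d.primeFactors.card : ℝ) * #(blockProducts N ε k) / Nat.totient d := by
  rw [← Finset.sum_add_distrib]
  have hsub : (Finset.range ⌈D⌉₊).filter (· ∣ primesProdBelow (y N)) ⊆ Finset.Icc 1 ⌈D⌉₊ := by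
    intro d hd
    rw [Finset.mem_filter, Finset.mem_range] at hd
    rw [Finset.mem_Icc]
    refine ⟨Nat.one_le_iff_ne_zero.mpr ?_, hd.1.le⟩
    rintro rfl
    exact primesProdBelow_ne_zero _ (zero_dvd_iff.mp hd.2)
  have hnonneg : ∀ d ∈ Finset.Icc 1 ⌈D⌉₊, 0 ≤ (⨆ c : (ZMod d)ˣ,
        ‖(∑ n ∈ Finset.Ioc 0 M, ∑ p ∈ blockPrimes N ε k,
            if ((n * p : ℕ) : ZMod d) = c then
              (if n ∈ blockProducts N ε k then (1 : ℂ) else 0) else 0) -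
          ((Nat.totient d : ℂ))⁻¹ *
            ∑ n ∈ Finset.Ioc 0 M, ∑ p ∈ blockPrimes N ε k,
              (if (n * p).Coprime d then (if n ∈ blockProducts N ε k then (1 : ℂ) else 0) else 0)‖) +
      (d.primeFactors.card : ℝ) * #(blockProducts N ε k) / Nat.totient d := by
    intro d _
    refine add_nonneg (Real.iSup_nonneg fun c : (ZMod d)ˣ => norm_nonneg _) (by positivity)
  refine le_trans (Finset.sum_le_sum fun d hd => ?_)
    (Finset.sum_le_sum_of_subset_of_nonneg hsub fun d hd _ => hnonneg d hd)
  -- one modulus `d ∣ P(y)`, `1 ≤ d`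
  have hdP : d ∣ primesProdBelow (y N) := (Finset.mem_filter.mp hd).2
  have hd1 : 1 ≤ d := (Finset.mem_Icc.mp (hsub hd)).1
  have hd0 : d ≠ 0 := by omega
  rw [Finset.card_product, Nat.cast_mul, ← card_blockProducts]
  by_cases hdN : d.Coprime N
  · -- coprime modulus: the bilinear discrepancy at the class of `N`
    have hg : shiftedPrimesDensity N d = ((Nat.totient d : ℝ))⁻¹ := by
      rw [shiftedPrimesDensity_apply, if_pos ⟨hdN, hd0⟩]
    rw [hg, show ((Nat.totient d : ℝ))⁻¹ * ((#(blockPrimes N ε k) : ℝ) * #(blockProducts N ε k)) =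
      (#(blockPrimes N ε k) : ℝ) * #(blockProducts N ε k) / Nat.totient d by ring]
    refine (abs_blockRemainder_le hN hε k hdP hdN hM).trans (add_le_add ?_ le_rfl)
    exact le_ciSup (f := fun c : (ZMod d)ˣ =>
      ‖(∑ n ∈ Finset.Ioc 0 M, ∑ p ∈ blockPrimes N ε k,
          if ((n * p : ℕ) : ZMod d) = c then
            (if n ∈ blockProducts N ε k then (1 : ℂ) else 0) else 0) -
        ((Nat.totient d : ℂ))⁻¹ *
          ∑ n ∈ Finset.Ioc 0 M, ∑ p ∈ blockPrimes N ε k,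
            (if (n * p).Coprime d then (if n ∈ blockProducts N ε k then (1 : ℂ) else 0) else 0)‖)
      (Set.finite_range _).bddAbove (resClass N d hdN)
  · -- modulus not coprime to `N`: the count and the density both vanish
    have hg : shiftedPrimesDensity N d = 0 := by
      rw [shiftedPrimesDensity_apply, if_neg (fun h => hdN h.1)]
    rw [hg, card_filter_dvd_tripleDist_eq_zero k hdP hdN]
    simp only [Nat.cast_zero, zero_mul, sub_zero, abs_zero]
    exact hnonneg d (hsub hd)

/-- The largest block index: `K(N, ε) = ⌊log(y/z)/log(1+ε)⌋` (Nathanson (10.12):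
`0 ≤ k ≤ log(y/z)/log(1+ε) ≪ ε⁻¹ log N`). [cite: Nathanson1996, Thm 10.6 (proof, (10.12))] -/
def maxGridIndex (N : ℕ) (ε : ℝ) : ℕ := ⌊Real.log (y N / z N) / Real.log (1 + ε)⌋₊

/-- For `z ≤ p < y`: `k(p) ≤ K(N, ε)`. [folklore] -/
theorem chenGridIndex_le_maxGridIndex {N : ℕ} {ε : ℝ} (hN : 0 < N) (hε : 0 < ε) {p : ℕ}
    (hz : z N ≤ (p : ℝ)) (hy : (p : ℝ) < y N) : chenGridIndex N ε p ≤ maxGridIndex N ε := by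
  unfold chenGridIndex maxGridIndex
  have hz0 : 0 < z N := Real.rpow_pos_of_pos (by exact_mod_cast hN) _
  have hp0 : (0 : ℝ) < p := hz0.trans_le hz
  have hlog1 : 0 < Real.log (1 + ε) := Real.log_pos (by linarith)
  refine Nat.floor_le_floor (div_le_div_of_nonneg_right (Real.log_le_log (div_pos hp0 hz0) ?_) hlog1.le)
  exact div_le_div_of_nonneg_right hy.le hz0.le

/-- **`R(N, ε, D) ≤ ∑_k R^{(k)}`** (Nathanson: `|B̃| = ∑_ℓ |B^{(ℓ)}|` and `R ≤ ∑_ℓ R^{(ℓ)}`): splitting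
`T̃` into its blocks `T_k = P_k × Q_k`, `0 ≤ k ≤ K(N, ε)`. [cite: Nathanson1996, Thm 10.6 (proof, p. 288)] -/
theorem switchedRemainderExt_le_sum_blocks {N : ℕ} {ε : ℝ} (hN : 2 ≤ N) (hε : 0 < ε) (D : ℝ) :
    switchedRemainderExt N ε D ≤
      ∑ k ∈ Finset.range (maxGridIndex N ε + 1),
        ∑ d ∈ (Finset.range ⌈D⌉₊).filter (· ∣ primesProdBelow (y N)),
          |(#((blockPrimes N ε k ×ˢ blockPairs N ε k).filter
              fun t : ℕ × ℕ × ℕ => d ∣ tripleDist N t) : ℝ) -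
            shiftedPrimesDensity N d * #(blockPrimes N ε k ×ˢ blockPairs N ε k)| := by
  classical
  have hNpos : 0 < N := by omega
  rw [Finset.sum_comm]
  unfold switchedRemainderExt
  refine Finset.sum_le_sum fun d _ => ?_
  -- fibres of the block label
  set T := switchedTriplesExt N ε with hT
  set f : ℕ × ℕ × ℕ → ℕ := fun t => chenGridIndex N ε t.1 with hf
  have hmaps : ∀ S : Finset (ℕ × ℕ × ℕ), S ⊆ T →
      (S : Set (ℕ × ℕ × ℕ)).MapsTo f (Finset.range (maxGridIndex N ε + 1) : Finset ℕ) := by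
    intro S hS t ht
    have ht' := mem_switchedTriplesExt.mp (hS (Finset.mem_coe.mp ht))
    rw [Finset.mem_coe, Finset.mem_range, Nat.lt_succ_iff]
    exact chenGridIndex_le_maxGridIndex hNpos hε ht'.2.2.2.2.1 ht'.2.2.2.2.2.1
  have hblock : ∀ k, T.filter (fun t => f t = k) = blockPrimes N ε k ×ˢ blockPairs N ε k := fun k =>
    switchedTriplesExt_filter_eq hN hε k
  -- the two counts are sums over the blocks
  have h1 : (#(T.filter fun t : ℕ × ℕ × ℕ => d ∣ tripleDist N t) : ℝ) =
      ∑ k ∈ Finset.range (maxGridIndex N ε + 1),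
        (#((blockPrimes N ε k ×ˢ blockPairs N ε k).filter
          fun t : ℕ × ℕ × ℕ => d ∣ tripleDist N t) : ℝ) := by
    rw [Finset.card_eq_sum_card_fiberwise (hmaps _ (Finset.filter_subset _ _)), Nat.cast_sum]
    refine Finset.sum_congr rfl fun k _ => ?_
    rw [Finset.filter_filter, ← hblock k, Finset.filter_filter]
    congr 2
    exact Finset.filter_congr fun t _ => and_comm
  have h2 : (#T : ℝ) = ∑ k ∈ Finset.range (maxGridIndex N ε + 1),
      (#(blockPrimes N ε k ×ˢ blockPairs N ε k) : ℝ) := by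
    rw [Finset.card_eq_sum_card_fiberwise (hmaps T le_rfl), Nat.cast_sum]
    exact Finset.sum_congr rfl fun k _ => by rw [hblock k]
  rw [h1, h2, Finset.mul_sum, ← Finset.sum_sub_distrib]
  exact Finset.abs_sum_le_sum_abs _ _


/-! ### Bookkeeping: every term of the explicit bilinear bound is `≪ N/(log N)⁴` per block -/

section Arith

/-- `1/log 2 ≤ 2`. [folklore] -/
theorem inv_log_two_le_two : 1 / Real.log 2 ≤ 2 := by
  have h := Real.log_two_gt_d9
  rw [div_le_iff₀ (by linarith)]
  linarith

/-- `√(4a) = 2√a`. [folklore] -/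
theorem sqrt_four_mul (a : ℝ) : Real.sqrt (4 * a) = 2 * Real.sqrt a := by
  rw [Real.sqrt_mul (by norm_num), show (4 : ℝ) = 2 ^ 2 by norm_num, Real.sqrt_sq (by norm_num)]

/-- The absorption step: `c L^k N/√ℓ ≤ N/L⁴` as soon as `c L^{k+4} ≤ √ℓ`. [folklore] -/
theorem mul_pow_mul_div_sqrt_le {c L N ℓ : ℝ} {k : ℕ} (hL : 0 < L) (hN : 0 < N)
    (hℓ : 0 < ℓ) (hck : c * L ^ (k + 4) ≤ Real.sqrt ℓ) :
    c * L ^ k * N / Real.sqrt ℓ ≤ N / L ^ 4 := by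
  have hsq : 0 < Real.sqrt ℓ := Real.sqrt_pos.mpr hℓ
  rw [div_le_div_iff₀ hsq (by positivity)]
  calc c * L ^ k * N * L ^ 4 = (c * L ^ (k + 4)) * N := by ring
    _ ≤ Real.sqrt ℓ * N := mul_le_mul_of_nonneg_right hck hN.le
    _ = N * Real.sqrt ℓ := by ring

variable {N L ℓ M T W : ℝ}

/-- Term B of the block bound: `W · 2(M+1)(T+1)/D₀ ≤ 144·16⁶ · N/L⁴`. [folklore] -/
theorem termB_le {D₀ : ℝ} (hL : 32 ≤ L) (hN0 : 0 < N) (hℓ1 : 1 ≤ ℓ) (hℓN : ℓ ≤ N)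
    (hM0 : 0 ≤ M) (hM : M ≤ 2 * N / ℓ) (hT0 : 0 ≤ T) (hT : T ≤ 2 * ℓ)
    (hD₀lo : (L / 16) ^ 6 / 2 ≤ D₀) (hW : W ≤ 4 * L ^ 2) :
    W * (2 * (M + 1) * (T + 1) / D₀) ≤ 144 * 16 ^ 6 * (N / L ^ 4) := by
  have hL0 : 0 < L := by linarith
  have hℓ0 : 0 < ℓ := by linarith
  have hD₀0 : 0 < D₀ := lt_of_lt_of_le (by positivity) hD₀lo
  have hNℓ : 1 ≤ N / ℓ := (one_le_div hℓ0).mpr hℓN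
  have hM1 : M + 1 ≤ 3 * N / ℓ := by
    have : 3 * N / ℓ = 2 * N / ℓ + N / ℓ := by ring
    rw [this]; linarith
  have hT1 : T + 1 ≤ 3 * ℓ := by linarith
  have hMT : (M + 1) * (T + 1) ≤ 9 * N := by
    calc (M + 1) * (T + 1) ≤ (3 * N / ℓ) * (3 * ℓ) :=
          mul_le_mul hM1 hT1 (by positivity) (by positivity)
      _ = 9 * N := by field_simp; norm_num
  have hL6 : L ^ 6 ≤ 2 * 16 ^ 6 * D₀ := by
    have h' : L ^ 6 / 16 ^ 6 / 2 ≤ D₀ := by rwa [div_pow] at hD₀lo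
    rw [div_div, div_le_iff₀ (by positivity)] at h'
    linarith
  have h1 : 2 * (M + 1) * (T + 1) / D₀ ≤ 36 * 16 ^ 6 * N / L ^ 6 := by
    rw [div_le_div_iff₀ hD₀0 (by positivity)]
    calc 2 * (M + 1) * (T + 1) * L ^ 6 = 2 * ((M + 1) * (T + 1)) * L ^ 6 := by ring
      _ ≤ 2 * (9 * N) * (2 * 16 ^ 6 * D₀) := by gcongr
      _ = 36 * 16 ^ 6 * N * D₀ := by ring
  calc W * (2 * (M + 1) * (T + 1) / D₀) ≤ (4 * L ^ 2) * (36 * 16 ^ 6 * N / L ^ 6) :=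
        mul_le_mul hW h1 (by positivity) (by positivity)
    _ = 144 * 16 ^ 6 * (N / L ^ 4) := by field_simp; ring

/-- Term D of the block bound: `W · 8√(MT) D ≤ N/L⁴` once `128 L⁶ ≤ N^δ`. [folklore] -/
theorem termD_le {D δ : ℝ} (hL : 32 ≤ L) (hN0 : 0 < N) (hℓ1 : 1 ≤ ℓ)
    (hM : M ≤ 2 * N / ℓ) (hT0 : 0 ≤ T) (hT : T ≤ 2 * ℓ)
    (hD0 : 0 ≤ D) (hD : D ≤ 2 * N ^ (1 / 2 - δ)) (hW : W ≤ 4 * L ^ 2)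
    (hev2 : 128 * L ^ 6 ≤ N ^ δ) :
    W * (8 * Real.sqrt (M * T) * D) ≤ N / L ^ 4 := by
  have hL0 : 0 < L := by linarith
  have hℓ0 : 0 < ℓ := by linarith
  have hsqMT : Real.sqrt (M * T) ≤ 2 * Real.sqrt N := by
    have h4N : M * T ≤ 4 * N := by
      calc M * T ≤ (2 * N / ℓ) * (2 * ℓ) := mul_le_mul hM hT hT0 (by positivity)
        _ = 4 * N := by field_simp; norm_num
    calc Real.sqrt (M * T) ≤ Real.sqrt (4 * N) := Real.sqrt_le_sqrt h4N
      _ = 2 * Real.sqrt N := sqrt_four_mul N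
  have hNδ : Real.sqrt N * N ^ (1 / 2 - δ) * N ^ δ = N := by
    rw [Real.sqrt_eq_rpow, ← Real.rpow_add hN0, ← Real.rpow_add hN0,
      show (1 : ℝ) / 2 + (1 / 2 - δ) + δ = 1 by ring, Real.rpow_one]
  have h2 : W * (8 * Real.sqrt (M * T) * D) ≤ 128 * L ^ 2 * (Real.sqrt N * N ^ (1 / 2 - δ)) := by
    have h1 : 8 * Real.sqrt (M * T) * D ≤ 32 * (Real.sqrt N * N ^ (1 / 2 - δ)) := by
      calc 8 * Real.sqrt (M * T) * D ≤ 8 * (2 * Real.sqrt N) * (2 * N ^ (1 / 2 - δ)) := by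
            gcongr
        _ = 32 * (Real.sqrt N * N ^ (1 / 2 - δ)) := by ring
    calc W * (8 * Real.sqrt (M * T) * D) ≤ (4 * L ^ 2) * (32 * (Real.sqrt N * N ^ (1 / 2 - δ))) :=
          mul_le_mul hW h1 (by positivity) (by positivity)
      _ = _ := by ring
  refine h2.trans ?_
  rw [le_div_iff₀ (by positivity)]
  have key : (128 * L ^ 6) * (Real.sqrt N * N ^ (1 / 2 - δ)) ≤ N := by
    calc (128 * L ^ 6) * (Real.sqrt N * N ^ (1 / 2 - δ))
        ≤ N ^ δ * (Real.sqrt N * N ^ (1 / 2 - δ)) := mul_le_mul_of_nonneg_right hev2 (by positivity)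
      _ = Real.sqrt N * N ^ (1 / 2 - δ) * N ^ δ := by ring
      _ = N := hNδ
  calc 128 * L ^ 2 * (Real.sqrt N * N ^ (1 / 2 - δ)) * L ^ 4
      = (128 * L ^ 6) * (Real.sqrt N * N ^ (1 / 2 - δ)) := by ring
    _ ≤ N := key

/-- Term C of the block bound: `W · 2(√M(T+1) + √T(M+1))(2 + log D) ≤ N/L⁴`. [folklore] -/
theorem termC_le {D : ℝ} (hL : 32 ≤ L) (hN0 : 0 < N) (hℓ1 : 1 ≤ ℓ) (hL18 : L ^ 18 ≤ Real.sqrt ℓ)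
    (hℓsqN : ℓ ≤ Real.sqrt N) (hM0 : 0 ≤ M) (hM : M ≤ 2 * N / ℓ) (hT0 : 0 ≤ T) (hT : T ≤ 2 * ℓ)
    (hD1 : 1 ≤ D) (hlogD : Real.log D ≤ L) (hW : W ≤ 4 * L ^ 2) :
    W * (2 * (Real.sqrt M * (T + 1) + Real.sqrt T * (M + 1)) * (2 + Real.log D)) ≤ N / L ^ 4 := by
  have hL0 : 0 < L := by linarith
  have hℓ0 : 0 < ℓ := by linarith
  have hsqℓ0 : 0 < Real.sqrt ℓ := Real.sqrt_pos.mpr hℓ0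
  have hsqℓ : Real.sqrt ℓ * Real.sqrt ℓ = ℓ := Real.mul_self_sqrt hℓ0.le
  have hsqN : Real.sqrt N * Real.sqrt N = N := Real.mul_self_sqrt hN0.le
  have hsqN0 : 0 < Real.sqrt N := Real.sqrt_pos.mpr hN0
  have hℓN : ℓ ≤ N := by
    have h1 : 1 ≤ Real.sqrt N := hℓ1.trans hℓsqN
    calc ℓ ≤ Real.sqrt N := hℓsqN
      _ = Real.sqrt N * 1 := by ring
      _ ≤ Real.sqrt N * Real.sqrt N := by gcongr
      _ = N := hsqN
  have hNℓ : 1 ≤ N / ℓ := (one_le_div hℓ0).mpr hℓN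
  have hM1 : M + 1 ≤ 3 * N / ℓ := by
    have : 3 * N / ℓ = 2 * N / ℓ + N / ℓ := by ring
    rw [this]; linarith
  have hT1 : T + 1 ≤ 3 * ℓ := by linarith
  have hsqM : Real.sqrt M ≤ 2 * Real.sqrt N / Real.sqrt ℓ := by
    have h4 : M ≤ 4 * (N / ℓ) := by
      have : 2 * N / ℓ = 2 * (N / ℓ) := by ring
      rw [this] at hM
      have : 0 ≤ N / ℓ := by positivity
      linarith
    calc Real.sqrt M ≤ Real.sqrt (4 * (N / ℓ)) := Real.sqrt_le_sqrt h4
      _ = 2 * Real.sqrt N / Real.sqrt ℓ := by rw [sqrt_four_mul, Real.sqrt_div' _ hℓ0.le]; ring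
  have hsqT : Real.sqrt T ≤ 2 * Real.sqrt ℓ := by
    calc Real.sqrt T ≤ Real.sqrt (4 * ℓ) := Real.sqrt_le_sqrt (by linarith)
      _ = 2 * Real.sqrt ℓ := sqrt_four_mul ℓ
  have hpiece1 : Real.sqrt M * (T + 1) ≤ 6 * N / Real.sqrt ℓ := by
    have e : (2 * Real.sqrt N / Real.sqrt ℓ) * (3 * ℓ) = 6 * Real.sqrt N * Real.sqrt ℓ := by
      rw [div_mul_eq_mul_div, div_eq_iff hsqℓ0.ne']
      calc 2 * Real.sqrt N * (3 * ℓ) = 6 * Real.sqrt N * (Real.sqrt ℓ * Real.sqrt ℓ) := by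
            rw [hsqℓ]; ring
        _ = 6 * Real.sqrt N * Real.sqrt ℓ * Real.sqrt ℓ := by ring
    calc Real.sqrt M * (T + 1) ≤ (2 * Real.sqrt N / Real.sqrt ℓ) * (3 * ℓ) :=
          mul_le_mul hsqM hT1 (by positivity) (by positivity)
      _ = 6 * Real.sqrt N * Real.sqrt ℓ := e
      _ ≤ 6 * N / Real.sqrt ℓ := by
          rw [le_div_iff₀ hsqℓ0]
          calc 6 * Real.sqrt N * Real.sqrt ℓ * Real.sqrt ℓ = 6 * Real.sqrt N * ℓ := by
                rw [mul_assoc, hsqℓ]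
            _ ≤ 6 * Real.sqrt N * Real.sqrt N := by gcongr
            _ = 6 * N := by rw [mul_assoc, hsqN]
  have hpiece2 : Real.sqrt T * (M + 1) ≤ 6 * N / Real.sqrt ℓ := by
    calc Real.sqrt T * (M + 1) ≤ (2 * Real.sqrt ℓ) * (3 * N / ℓ) :=
          mul_le_mul hsqT hM1 (by positivity) (by positivity)
      _ = 6 * N / Real.sqrt ℓ := by
          rw [eq_div_iff hsqℓ0.ne']
          calc 2 * Real.sqrt ℓ * (3 * N / ℓ) * Real.sqrt ℓ = 6 * N * (Real.sqrt ℓ * Real.sqrt ℓ) / ℓ := by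
                ring
            _ = 6 * N := by rw [hsqℓ]; field_simp
  have h1 : Real.sqrt M * (T + 1) + Real.sqrt T * (M + 1) ≤ 12 * N / Real.sqrt ℓ := by
    calc Real.sqrt M * (T + 1) + Real.sqrt T * (M + 1) ≤ 6 * N / Real.sqrt ℓ + 6 * N / Real.sqrt ℓ :=
          add_le_add hpiece1 hpiece2
      _ = 12 * N / Real.sqrt ℓ := by ring
  have h2 : 2 + Real.log D ≤ 2 * L := by linarith
  have hlogD0 : 0 ≤ 2 + Real.log D := by have := Real.log_nonneg hD1; linarith
  have h3 : W * (2 * (Real.sqrt M * (T + 1) + Real.sqrt T * (M + 1)) * (2 + Real.log D)) ≤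
      (4 * L ^ 2) * (2 * (12 * N / Real.sqrt ℓ) * (2 * L)) := by
    refine mul_le_mul hW ?_ (by positivity) (by positivity)
    exact mul_le_mul (mul_le_mul_of_nonneg_left h1 (by norm_num)) h2 hlogD0 (by positivity)
  refine h3.trans ?_
  have h32 : (32 : ℝ) ^ 11 ≤ L ^ 11 := pow_le_pow_left₀ (by norm_num) hL 11
  have hX3 : 192 * L ^ 3 * N / Real.sqrt ℓ ≤ N / L ^ 4 := by
    refine mul_pow_mul_div_sqrt_le hL0 hN0 hℓ0 ?_
    calc 192 * L ^ (3 + 4) ≤ L ^ 11 * L ^ 7 := by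
          rw [show (3 + 4 : ℕ) = 7 from rfl]
          exact mul_le_mul_of_nonneg_right (le_trans (by norm_num) h32) (by positivity)
      _ = L ^ 18 := by ring
      _ ≤ Real.sqrt ℓ := hL18
  refine le_trans (le_of_eq ?_) hX3
  ring

/-- Term A of the block bound: `W D₀ M V₀ ≤ (3 + 2²⁸ C₂) N/L⁴`. [folklore] -/
theorem termA_le {Y D D₀ C₂ : ℝ} (hL : 32 ≤ L) (hN0 : 0 < N) (hℓ1 : 1 ≤ ℓ)
    (hL18 : L ^ 18 ≤ Real.sqrt ℓ) (hM0 : 0 ≤ M) (hM : M ≤ 2 * N / ℓ)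
    (hY9 : 9 ≤ Y) (hY : Y ≤ 2 * ℓ) (hlogY : L / 8 ≤ Real.log Y) (hlogY1 : Real.log (Y + 1) ≤ L)
    (hD1 : 1 ≤ D) (hlogD : Real.log D ≤ L) (hD₀lo : (L / 16) ^ 6 / 2 ≤ D₀)
    (hD₀hi : D₀ ≤ (L / 16) ^ 6) (hW : W ≤ 4 * L ^ 2) (hC₂ : 0 ≤ C₂) :
    W * (D₀ * M *
        (2 * (D₀ * (7 * Real.sqrt Y + C₂ * 2 ^ 20 * Y / Real.log Y ^ 20) / Real.log 2 +
            2 * Real.sqrt (Y + 1) * Real.log (Y + 1) / Real.log 2) +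
          L / Real.log 2 + Real.log D / Real.log 2)) ≤ (3 + 2 ^ 28 * C₂) * (N / L ^ 4) := by
  have hL0 : 0 < L := by linarith
  have hℓ0 : 0 < ℓ := by linarith
  have hsqℓ0 : 0 < Real.sqrt ℓ := Real.sqrt_pos.mpr hℓ0
  have hsqℓ : Real.sqrt ℓ * Real.sqrt ℓ = ℓ := Real.mul_self_sqrt hℓ0.le
  have hsqℓ_le : Real.sqrt ℓ ≤ ℓ := by rw [Real.sqrt_le_left hℓ0.le]; nlinarith
  have hD₀0 : 0 < D₀ := lt_of_lt_of_le (by positivity) hD₀lo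
  have hlog2 := Real.log_two_gt_d9
  have hl2pos : 0 < Real.log 2 := by linarith
  have hil2 : ∀ a : ℝ, 0 ≤ a → a / Real.log 2 ≤ 2 * a := fun a ha => by
    rw [div_le_iff₀ hl2pos]; nlinarith
  have hL1 : 1 ≤ L := by linarith
  have hpowL : ∀ {m n : ℕ}, m ≤ n → L ^ m ≤ L ^ n := fun h => pow_le_pow_right₀ hL1 h
  -- absorptions
  have hX14 : L ^ 14 * N / Real.sqrt ℓ ≤ N / L ^ 4 := by
    have := mul_pow_mul_div_sqrt_le (k := 14) (c := 1) hL0 hN0 hℓ0 (by rw [one_mul]; exact hL18)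
    rwa [one_mul] at this
  have hX9 : L ^ 9 * N / Real.sqrt ℓ ≤ N / L ^ 4 := by
    have := mul_pow_mul_div_sqrt_le (k := 9) (c := 1) hL0 hN0 hℓ0
      (by rw [one_mul]; exact (hpowL (by norm_num)).trans hL18)
    rwa [one_mul] at this
  have hX9' : L ^ 9 * N / ℓ ≤ N / L ^ 4 :=
    (div_le_div_of_nonneg_left (by positivity) hsqℓ0 hsqℓ_le).trans hX9
  -- `S ≤ 14√ℓ + C₂ 2^81 ℓ/L^20`
  have hlogY0 : 0 < Real.log Y := by linarith
  have hS : 7 * Real.sqrt Y + C₂ * 2 ^ 20 * Y / Real.log Y ^ 20 ≤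
      14 * Real.sqrt ℓ + C₂ * 2 ^ 81 * ℓ / L ^ 20 := by
    have h1 : Real.sqrt Y ≤ 2 * Real.sqrt ℓ := by
      calc Real.sqrt Y ≤ Real.sqrt (4 * ℓ) := Real.sqrt_le_sqrt (by linarith)
        _ = 2 * Real.sqrt ℓ := sqrt_four_mul ℓ
    have h2 : Y / Real.log Y ^ 20 ≤ 2 * ℓ * (8 ^ 20 / L ^ 20) := by
      have hpow : (L / 8) ^ 20 ≤ Real.log Y ^ 20 := pow_le_pow_left₀ (by positivity) hlogY 20
      calc Y / Real.log Y ^ 20 ≤ (2 * ℓ) / (L / 8) ^ 20 := by gcongr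
        _ = 2 * ℓ * (8 ^ 20 / L ^ 20) := by rw [div_pow]; field_simp
    calc 7 * Real.sqrt Y + C₂ * 2 ^ 20 * Y / Real.log Y ^ 20
        = 7 * Real.sqrt Y + C₂ * 2 ^ 20 * (Y / Real.log Y ^ 20) := by ring
      _ ≤ 7 * (2 * Real.sqrt ℓ) + C₂ * 2 ^ 20 * (2 * ℓ * (8 ^ 20 / L ^ 20)) := by gcongr
      _ = 14 * Real.sqrt ℓ + C₂ * 2 ^ 81 * ℓ / L ^ 20 := by norm_num; ring
  -- `V ≤ 4 D₀ (…) + 16 √ℓ L + 4L`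
  have hV : 2 * (D₀ * (7 * Real.sqrt Y + C₂ * 2 ^ 20 * Y / Real.log Y ^ 20) / Real.log 2 +
        2 * Real.sqrt (Y + 1) * Real.log (Y + 1) / Real.log 2) +
      L / Real.log 2 + Real.log D / Real.log 2 ≤
      4 * D₀ * (14 * Real.sqrt ℓ + C₂ * 2 ^ 81 * ℓ / L ^ 20) + 16 * Real.sqrt ℓ * L + 4 * L := by
    have hsqY1 : Real.sqrt (Y + 1) ≤ 2 * Real.sqrt ℓ := by
      calc Real.sqrt (Y + 1) ≤ Real.sqrt (4 * ℓ) := Real.sqrt_le_sqrt (by linarith)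
        _ = 2 * Real.sqrt ℓ := sqrt_four_mul ℓ
    have hlogY1' : 0 ≤ Real.log (Y + 1) := Real.log_nonneg (by linarith)
    have e1 := hil2 (D₀ * (7 * Real.sqrt Y + C₂ * 2 ^ 20 * Y / Real.log Y ^ 20)) (by positivity)
    have e2 := hil2 (Real.sqrt (Y + 1) * Real.log (Y + 1)) (by positivity)
    have e3 := hil2 L hL0.le
    have e4 := hil2 (Real.log D) (Real.log_nonneg hD1)
    have e5 : D₀ * (7 * Real.sqrt Y + C₂ * 2 ^ 20 * Y / Real.log Y ^ 20) ≤
        D₀ * (14 * Real.sqrt ℓ + C₂ * 2 ^ 81 * ℓ / L ^ 20) := mul_le_mul_of_nonneg_left hS hD₀0.le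
    have e6 : Real.sqrt (Y + 1) * Real.log (Y + 1) ≤ 2 * Real.sqrt ℓ * L :=
      mul_le_mul hsqY1 hlogY1 hlogY1' (by positivity)
    have e2' : 2 * Real.sqrt (Y + 1) * Real.log (Y + 1) / Real.log 2 =
        2 * (Real.sqrt (Y + 1) * Real.log (Y + 1) / Real.log 2) := by ring
    rw [e2']
    linarith
  -- `W D₀ M ≤ Q := 8 L^8 N/(16^6 ℓ)`
  set Q : ℝ := 8 * L ^ 8 * N / (16 ^ 6 * ℓ) with hQdef
  have hQ : W * (D₀ * M) ≤ Q := by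
    calc W * (D₀ * M) ≤ (4 * L ^ 2) * ((L / 16) ^ 6 * (2 * N / ℓ)) :=
          mul_le_mul hW (mul_le_mul hD₀hi hM hM0 (by positivity)) (by positivity) (by positivity)
      _ = Q := by rw [hQdef, div_pow]; field_simp; ring
  have hQ0 : 0 ≤ Q := by positivity
  -- the four pieces
  have hA1 : Q * (4 * D₀ * (14 * Real.sqrt ℓ)) ≤ N / L ^ 4 := by
    calc Q * (4 * D₀ * (14 * Real.sqrt ℓ)) ≤ Q * (4 * (L / 16) ^ 6 * (14 * Real.sqrt ℓ)) := by gcongr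
      _ = (448 / 16 ^ 12) * (L ^ 14 * N / Real.sqrt ℓ) := by
          rw [hQdef, div_pow]
          have hℓs : ℓ = Real.sqrt ℓ ^ 2 := (Real.sq_sqrt hℓ0.le).symm
          generalize Real.sqrt ℓ = s at hℓs hsqℓ0 ⊢
          subst hℓs
          field_simp
          ring
      _ ≤ 1 * (L ^ 14 * N / Real.sqrt ℓ) := by gcongr; norm_num
      _ ≤ N / L ^ 4 := by rw [one_mul]; exact hX14
  have hA2 : Q * (4 * D₀ * (C₂ * 2 ^ 81 * ℓ / L ^ 20)) ≤ 2 ^ 28 * C₂ * (N / L ^ 4) := by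
    have h32 : (32 : ℝ) ^ 2 ≤ L ^ 2 := pow_le_pow_left₀ (by norm_num) hL 2
    calc Q * (4 * D₀ * (C₂ * 2 ^ 81 * ℓ / L ^ 20))
        ≤ Q * (4 * (L / 16) ^ 6 * (C₂ * 2 ^ 81 * ℓ / L ^ 20)) := by gcongr
      _ = 2 ^ 38 * C₂ * (N / L ^ 4) / L ^ 2 := by
          rw [hQdef, div_pow]
          field_simp
          ring
      _ ≤ 2 ^ 38 * C₂ * (N / L ^ 4) / 2 ^ 10 := by
          refine div_le_div_of_nonneg_left (by positivity) (by positivity) ?_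
          nlinarith
      _ = 2 ^ 28 * C₂ * (N / L ^ 4) := by ring
  have hA3 : Q * (16 * Real.sqrt ℓ * L) ≤ N / L ^ 4 := by
    calc Q * (16 * Real.sqrt ℓ * L) = (128 / 16 ^ 6) * (L ^ 9 * N / Real.sqrt ℓ) := by
          rw [hQdef]
          have hℓs : ℓ = Real.sqrt ℓ ^ 2 := (Real.sq_sqrt hℓ0.le).symm
          generalize Real.sqrt ℓ = s at hℓs hsqℓ0 ⊢
          subst hℓs
          field_simp
          ring
      _ ≤ 1 * (L ^ 9 * N / Real.sqrt ℓ) := by gcongr; norm_num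
      _ ≤ N / L ^ 4 := by rw [one_mul]; exact hX9
  have hA4 : Q * (4 * L) ≤ N / L ^ 4 := by
    calc Q * (4 * L) = (32 / 16 ^ 6) * (L ^ 9 * N / ℓ) := by rw [hQdef]; field_simp; ring
      _ ≤ 1 * (L ^ 9 * N / ℓ) := by gcongr; norm_num
      _ ≤ N / L ^ 4 := by rw [one_mul]; exact hX9'
  have hV0 : 0 ≤ 2 * (D₀ * (7 * Real.sqrt Y + C₂ * 2 ^ 20 * Y / Real.log Y ^ 20) / Real.log 2 +
        2 * Real.sqrt (Y + 1) * Real.log (Y + 1) / Real.log 2) +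
      L / Real.log 2 + Real.log D / Real.log 2 := by
    have : 0 ≤ Real.log (Y + 1) := Real.log_nonneg (by linarith)
    have : 0 ≤ Real.log D := Real.log_nonneg hD1
    positivity
  calc _ = (W * (D₀ * M)) *
        (2 * (D₀ * (7 * Real.sqrt Y + C₂ * 2 ^ 20 * Y / Real.log Y ^ 20) / Real.log 2 +
            2 * Real.sqrt (Y + 1) * Real.log (Y + 1) / Real.log 2) +
          L / Real.log 2 + Real.log D / Real.log 2) := by ring
    _ ≤ Q * (4 * D₀ * (14 * Real.sqrt ℓ + C₂ * 2 ^ 81 * ℓ / L ^ 20) + 16 * Real.sqrt ℓ * L + 4 * L) :=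
        mul_le_mul hQ hV hV0 hQ0
    _ = Q * (4 * D₀ * (14 * Real.sqrt ℓ)) + Q * (4 * D₀ * (C₂ * 2 ^ 81 * ℓ / L ^ 20)) +
        Q * (16 * Real.sqrt ℓ * L) + Q * (4 * L) := by ring
    _ ≤ N / L ^ 4 + 2 ^ 28 * C₂ * (N / L ^ 4) + N / L ^ 4 + N / L ^ 4 := by
        linarith [hA1, hA2, hA3, hA4]
    _ = (3 + 2 ^ 28 * C₂) * (N / L ^ 4) := by ring

/-- **Arithmetic of the block bound.** With `L = log N ≥ 32`, `N^{1/8} ≤ ℓ ≤ N^{1/3}`,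
`M ≤ 2N/ℓ`, `T ≤ 2ℓ`, `9 ≤ Y ≤ 2ℓ`, `log Y ≥ L/8`, `log(Y+1) ≤ L`, `1 ≤ D ≤ 2N^{1/2−δ}`, `log D ≤ L`,
`(L/16)⁶/2 ≤ D₀ ≤ (L/16)⁶`, `W ≤ 4L²` and the eventual conditions `L¹⁸ ≤ N^{1/16}`,
`128 L⁶ ≤ N^δ`, the explicit bound of `Bilinear.primes_explicit` (Siegel–Walfisz exponent `20`,
constant `C₂`) for one block is at most `(3·10⁹ + 3·10⁸ C₂) N/L⁴` (Nathanson p. 295: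
`R^{(ℓ)} ≪ N/(log N)^{A−2} + N^{7/8}(log D*)² ≪ N/(log N)⁴` with `A = 6`).
[cite: Nathanson1996, Thm 10.6 (proof, p. 295)] -/
theorem blockBound_arith {Y D D₀ C₂ δ : ℝ} (hL : 32 ≤ L) (hN1 : 1 ≤ N)
    (hℓ1 : 1 ≤ ℓ) (hℓlo : N ^ (1 / 8 : ℝ) ≤ ℓ) (hℓhi : ℓ ≤ N ^ (1 / 3 : ℝ))
    (hM0 : 0 ≤ M) (hM : M ≤ 2 * N / ℓ) (hT0 : 0 ≤ T) (hT : T ≤ 2 * ℓ)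
    (hY9 : 9 ≤ Y) (hY : Y ≤ 2 * ℓ) (hlogY : L / 8 ≤ Real.log Y) (hlogY1 : Real.log (Y + 1) ≤ L)
    (hD1 : 1 ≤ D) (hD : D ≤ 2 * N ^ (1 / 2 - δ)) (hlogD : Real.log D ≤ L)
    (hD₀lo : (L / 16) ^ 6 / 2 ≤ D₀) (hD₀hi : D₀ ≤ (L / 16) ^ 6) (hW : W ≤ 4 * L ^ 2)
    (hC₂ : 0 ≤ C₂) (hev1 : L ^ 18 ≤ N ^ (1 / 16 : ℝ)) (hev2 : 128 * L ^ 6 ≤ N ^ δ) :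
    W * (D₀ * M *
          (2 * (D₀ * (7 * Real.sqrt Y + C₂ * 2 ^ 20 * Y / Real.log Y ^ 20) / Real.log 2 +
              2 * Real.sqrt (Y + 1) * Real.log (Y + 1) / Real.log 2) +
            L / Real.log 2 + Real.log D / Real.log 2) +
        (2 * (M + 1) * (T + 1) / D₀ +
          2 * (Real.sqrt M * (T + 1) + Real.sqrt T * (M + 1)) * (2 + Real.log D) +
            8 * Real.sqrt (M * T) * D)) ≤
      (3 * 10 ^ 9 + 3 * 10 ^ 8 * C₂) * N / L ^ 4 := by
  have hL0 : 0 < L := by linarith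
  have hN0 : 0 < N := by linarith
  have hℓ0 : 0 < ℓ := by linarith
  -- derived facts
  have hsqrtℓ : N ^ (1 / 16 : ℝ) ≤ Real.sqrt ℓ := by
    rw [show (1 / 16 : ℝ) = 1 / 8 * (1 / 2) by norm_num, Real.rpow_mul hN0.le,
      Real.sqrt_eq_rpow]
    exact Real.rpow_le_rpow (by positivity) hℓlo (by norm_num)
  have hL18 : L ^ 18 ≤ Real.sqrt ℓ := hev1.trans hsqrtℓ
  have hℓsqN : ℓ ≤ Real.sqrt N := by
    rw [Real.sqrt_eq_rpow]
    exact hℓhi.trans (Real.rpow_le_rpow_of_exponent_le hN1 (by norm_num))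
  have hℓN : ℓ ≤ N := by
    refine hℓhi.trans ?_
    have := Real.rpow_le_rpow_of_exponent_le hN1 (show (1 / 3 : ℝ) ≤ 1 by norm_num)
    rwa [Real.rpow_one] at this
  have hD0 : 0 ≤ D := by linarith
  have hA := termA_le hL hN0 hℓ1 hL18 hM0 hM hY9 hY hlogY hlogY1 hD1 hlogD hD₀lo hD₀hi hW hC₂
  have hB := termB_le hL hN0 hℓ1 hℓN hM0 hM hT0 hT hD₀lo hW
  have hC := termC_le hL hN0 hℓ1 hL18 hℓsqN hM0 hM hT0 hT hD1 hlogD hW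
  have hD' := termD_le hL hN0 hℓ1 hM hT0 hT hD0 hD hW hev2
  have hX0 : 0 < N / L ^ 4 := by positivity
  have htot : W * (D₀ * M *
          (2 * (D₀ * (7 * Real.sqrt Y + C₂ * 2 ^ 20 * Y / Real.log Y ^ 20) / Real.log 2 +
              2 * Real.sqrt (Y + 1) * Real.log (Y + 1) / Real.log 2) +
            L / Real.log 2 + Real.log D / Real.log 2) +
        (2 * (M + 1) * (T + 1) / D₀ +
          2 * (Real.sqrt M * (T + 1) + Real.sqrt T * (M + 1)) * (2 + Real.log D) +
            8 * Real.sqrt (M * T) * D)) =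
      W * (D₀ * M *
          (2 * (D₀ * (7 * Real.sqrt Y + C₂ * 2 ^ 20 * Y / Real.log Y ^ 20) / Real.log 2 +
              2 * Real.sqrt (Y + 1) * Real.log (Y + 1) / Real.log 2) +
            L / Real.log 2 + Real.log D / Real.log 2)) +
      W * (2 * (M + 1) * (T + 1) / D₀) +
      W * (2 * (Real.sqrt M * (T + 1) + Real.sqrt T * (M + 1)) * (2 + Real.log D)) +
      W * (8 * Real.sqrt (M * T) * D) := by ring
  rw [htot]
  have hfin : (3 + 2 ^ 28 * C₂) * (N / L ^ 4) + 144 * 16 ^ 6 * (N / L ^ 4) + N / L ^ 4 + N / L ^ 4 ≤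
      (3 * 10 ^ 9 + 3 * 10 ^ 8 * C₂) * N / L ^ 4 := by
    rw [mul_div_assoc]
    nlinarith [mul_nonneg hC₂ hX0.le]
  linarith

end Arith


/-! ### The estimate for one block, and (10.15) summed over the blocks -/

/-- `ℓ_k ≤ y` for `k ≤ K(N, ε)` (`(1+ε)^{K} ≤ y/z`). [folklore] -/
theorem gridLevel_le_y {N : ℕ} {ε : ℝ} (hN : 2 ≤ N) (hε : 0 < ε) {k : ℕ}
    (hk : k ≤ maxGridIndex N ε) : gridLevel N ε k ≤ y N := by
  have hN0 : (0 : ℝ) < N := by exact_mod_cast (show 0 < N by omega)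
  have hN1 : (1 : ℝ) < N := by exact_mod_cast (show 1 < N by omega)
  have hz0 : 0 < z N := Real.rpow_pos_of_pos hN0 _
  have hzy : z N ≤ y N := Real.rpow_le_rpow_of_exponent_le hN1.le (by norm_num)
  have hlog1 : 0 < Real.log (1 + ε) := Real.log_pos (by linarith)
  set q : ℝ := Real.log (y N / z N) / Real.log (1 + ε) with hq
  have hq0 : 0 ≤ q := div_nonneg (Real.log_nonneg ((one_le_div hz0).mpr hzy)) hlog1.le
  have hK : (maxGridIndex N ε : ℝ) ≤ q := Nat.floor_le hq0
  have hk' : (k : ℝ) ≤ q := le_trans (by exact_mod_cast hk) hK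
  have hpow : (1 + ε) ^ k ≤ y N / z N := by
    rw [← Real.rpow_natCast, Real.rpow_def_of_pos (by linarith)]
    calc Real.exp (Real.log (1 + ε) * k) ≤ Real.exp (Real.log (1 + ε) * q) :=
          Real.exp_le_exp.mpr (mul_le_mul_of_nonneg_left hk' hlog1.le)
      _ = y N / z N := by rw [hq, mul_div_cancel₀ _ hlog1.ne', Real.exp_log (div_pos (hz0.trans_le hzy |> fun h => by linarith [hz0]) hz0)]
  unfold gridLevel
  calc z N * (1 + ε) ^ k ≤ z N * (y N / z N) := mul_le_mul_of_nonneg_left hpow hz0.le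
    _ = y N := mul_div_cancel₀ _ hz0.ne'

/-- `K(N, ε) + 1 ≤ (1/log(1+ε) + 1) log N` for `N ≥ 3`. [folklore] -/
theorem maxGridIndex_add_one_le {N : ℕ} {ε : ℝ} (hN : 3 ≤ N) (hε : 0 < ε) :
    (maxGridIndex N ε : ℝ) + 1 ≤ (1 / Real.log (1 + ε) + 1) * Real.log N := by
  have hN0 : (0 : ℝ) < N := by exact_mod_cast (show 0 < N by omega)
  have hN3 : (3 : ℝ) ≤ N := by exact_mod_cast hN
  have hlogN : 1 ≤ Real.log N := by
    rw [Real.le_log_iff_exp_le hN0]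
    exact Real.exp_one_lt_d9.le.trans (by linarith)
  have hlog1 : 0 < Real.log (1 + ε) := Real.log_pos (by linarith)
  have hyz : Real.log (y N / z N) = 5 / 24 * Real.log N := by
    rw [y, z, ← Real.rpow_sub hN0, Real.log_rpow hN0]; norm_num
  have hK : (maxGridIndex N ε : ℝ) ≤ Real.log N / Real.log (1 + ε) := by
    refine (Nat.floor_le (div_nonneg ?_ hlog1.le)).trans ?_
    · rw [hyz]; positivity
    · rw [hyz]; exact div_le_div_of_nonneg_right (by nlinarith) hlog1.le
  calc (maxGridIndex N ε : ℝ) + 1 ≤ Real.log N / Real.log (1 + ε) + Real.log N := by linarith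
    _ = (1 / Real.log (1 + ε) + 1) * Real.log N := by ring

set_option maxHeartbeats 800000 in
open scoped Classical in
/-- **The estimate for one block** (Nathanson (10.15): `R^{(ℓ)} ≪ N/(log N)⁴`): for
`0 < ε ≤ 1`, `0 < δ ≤ 1/4`, `N ≥ 9⁸` with `log N ≥ 32`, `(log N)¹⁸ ≤ N^{1/16}`, `128(log N)⁶ ≤ N^δ`,
and every block `k ≤ K(N, ε)`, the bilinear discrepancy sum of `Bilinear.primes_explicit` for the
block (level `⌈N^{1/2−δ}⌉`, `a = 1_{M_k}`, `K = N`, `D₀ = ⌊(log N/16)⁶⌋`, Siegel–Walfisz exponent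
`20` with constant `C₂`) plus the correction `∑_d ω(d) #M_k/φ(d)` is at most
`(3·10⁹ + 3·10⁸ C₂ + 1) N/(log N)⁴`. [cite: Nathanson1996, Thm 10.6 (proof, (10.15), p. 295)] -/
theorem blockTotal_le {C₂ : ℝ} (hC₂0 : 0 ≤ C₂) (hSW : SWBound ((20 : ℕ) : ℝ) C₂) {ε δ : ℝ}
    (hε : 0 < ε) (hε1 : ε ≤ 1) (hδ : 0 < δ) (hδ1 : δ ≤ 1 / 4) {N : ℕ} (hN : 9 ^ 8 ≤ N)
    (hL : 32 ≤ Real.log N) (hev1 : Real.log N ^ 18 ≤ (N : ℝ) ^ (1 / 16 : ℝ))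
    (hev2 : 128 * Real.log N ^ 6 ≤ (N : ℝ) ^ δ) {k : ℕ} (hk : k ≤ maxGridIndex N ε) :
    (∑ d ∈ Finset.Icc 1 ⌈(N : ℝ) ^ (1 / 2 - δ)⌉₊, (⨆ c : (ZMod d)ˣ,
        ‖(∑ n ∈ Finset.Ioc 0 ⌈(N : ℝ) / gridLevel N ε k⌉₊, ∑ p ∈ blockPrimes N ε k,
            if ((n * p : ℕ) : ZMod d) = c then
              (if n ∈ blockProducts N ε k then (1 : ℂ) else 0) else 0) -
          ((Nat.totient d : ℂ))⁻¹ *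
            ∑ n ∈ Finset.Ioc 0 ⌈(N : ℝ) / gridLevel N ε k⌉₊, ∑ p ∈ blockPrimes N ε k,
              (if (n * p).Coprime d then
                (if n ∈ blockProducts N ε k then (1 : ℂ) else 0) else 0)‖)) +
      ∑ d ∈ Finset.Icc 1 ⌈(N : ℝ) ^ (1 / 2 - δ)⌉₊,
        (d.primeFactors.card : ℝ) * #(blockProducts N ε k) / Nat.totient d ≤
      (3 * 10 ^ 9 + 3 * 10 ^ 8 * C₂ + 1) * N / Real.log N ^ 4 := by
  -- basic quantities
  have hN2 : 2 ≤ N := le_trans (by norm_num) hN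
  have hNpos : 0 < N := by omega
  have hN0 : (0 : ℝ) < N := by exact_mod_cast hNpos
  have hN1 : (1 : ℝ) ≤ N := by exact_mod_cast (show 1 ≤ N by omega)
  have hN1' : (1 : ℝ) < N := by exact_mod_cast (show 1 < N by omega)
  set L : ℝ := Real.log N with hLdef
  have hL0 : 0 < L := by linarith
  have hL1 : 1 ≤ L := by linarith
  set ℓ : ℝ := gridLevel N ε k with hℓdef
  obtain ⟨hℓ0, hzℓ⟩ := gridLevel_pos hNpos hε k
  have hz9 : (9 : ℝ) ≤ z N := by
    rw [z, show (9 : ℝ) = ((9 : ℝ) ^ (8 : ℕ)) ^ (1 / 8 : ℝ) by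
      rw [← Real.rpow_natCast, ← Real.rpow_mul (by norm_num)]; norm_num]
    exact Real.rpow_le_rpow (by norm_num) (by exact_mod_cast hN) (by norm_num)
  have hℓ9 : 9 ≤ ℓ := hz9.trans hzℓ
  have hℓ1 : 1 ≤ ℓ := by linarith
  have hℓlo : (N : ℝ) ^ (1 / 8 : ℝ) ≤ ℓ := hzℓ
  have hℓy : ℓ ≤ y N := gridLevel_le_y hN2 hε hk
  have hℓhi : ℓ ≤ (N : ℝ) ^ (1 / 3 : ℝ) := hℓy
  have hyN : y N ≤ N := by
    have := Real.rpow_le_rpow_of_exponent_le hN1 (show (1 / 3 : ℝ) ≤ 1 by norm_num)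
    rwa [Real.rpow_one] at this
  have hℓN : ℓ ≤ N := hℓy.trans hyN
  have hlogz : Real.log (z N) = 1 / 8 * L := Real.log_rpow hN0 _
  -- `Y`, `TY`, `M`, `D`, `D₀`
  set Y : ℝ := min (y N) ((1 + ε) * ℓ) with hYdef
  have hℓY : ℓ ≤ Y := le_min hℓy (by nlinarith)
  have hY9 : 9 ≤ Y := hℓ9.trans hℓY
  have hYℓ : Y ≤ 2 * ℓ := (min_le_right _ _).trans (by nlinarith)
  have hY0 : 0 < Y := by linarith
  have hlogY : L / 8 ≤ Real.log Y := by
    have := Real.log_le_log (by linarith) (hzℓ.trans hℓY)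
    rw [hlogz] at this; linarith
  have h4N : (4 : ℝ) ≤ N := by exact_mod_cast le_trans (by norm_num) hN
  have hs2 : 2 ≤ Real.sqrt N := by
    calc (2 : ℝ) = Real.sqrt 4 := by
          rw [show (4 : ℝ) = 2 ^ 2 by norm_num, Real.sqrt_sq (by norm_num)]
      _ ≤ Real.sqrt N := Real.sqrt_le_sqrt h4N
  have hsN : Real.sqrt N * Real.sqrt N = N := Real.mul_self_sqrt hN0.le
  have hYN : Y + 1 ≤ N := by
    have h1 : Y ≤ y N := min_le_left _ _
    have h2 : y N ≤ Real.sqrt N := by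
      rw [Real.sqrt_eq_rpow]
      exact Real.rpow_le_rpow_of_exponent_le hN1 (by norm_num)
    calc Y + 1 ≤ Real.sqrt N + 1 := by linarith
      _ ≤ Real.sqrt N + Real.sqrt N := by linarith
      _ = 2 * Real.sqrt N := by ring
      _ ≤ Real.sqrt N * Real.sqrt N := mul_le_mul_of_nonneg_right hs2 (Real.sqrt_nonneg N)
      _ = N := hsN
  have hlogY1 : Real.log (Y + 1) ≤ L := Real.log_le_log (by linarith) hYN
  set TY : ℕ := ⌈Y⌉₊ with hTYdef
  have hTY : (TY : ℝ) ≤ Y + 1 := (Nat.ceil_lt_add_one hY0.le).le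
  set T : ℝ := ((TY - 1 : ℕ) : ℝ) with hTdef
  have hT0 : 0 ≤ T := Nat.cast_nonneg _
  have hT : T ≤ 2 * ℓ := by
    have : T ≤ Y := by
      rw [hTdef]
      rcases Nat.eq_zero_or_pos TY with h0 | hpos
      · rw [h0]; simp; linarith
      · rw [Nat.cast_sub hpos, Nat.cast_one]; linarith
    exact this.trans hYℓ
  set M : ℕ := ⌈(N : ℝ) / ℓ⌉₊ with hMdef
  have hNℓ1 : 1 ≤ (N : ℝ) / ℓ := (one_le_div hℓ0).mpr hℓN
  have hM : (M : ℝ) ≤ 2 * N / ℓ := by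
    have := (Nat.ceil_lt_add_one (by positivity : (0 : ℝ) ≤ N / ℓ)).le
    calc (M : ℝ) ≤ N / ℓ + 1 := this
      _ ≤ N / ℓ + N / ℓ := by linarith
      _ = 2 * N / ℓ := by ring
  have hM0 : (0 : ℝ) ≤ M := Nat.cast_nonneg _
  set Dc : ℕ := ⌈(N : ℝ) ^ (1 / 2 - δ)⌉₊ with hDcdef
  have hNδ1 : (1 : ℝ) ≤ (N : ℝ) ^ (1 / 2 - δ) := Real.one_le_rpow hN1 (by linarith)
  have hDc1 : (1 : ℝ) ≤ Dc := by
    have : 1 ≤ Dc := Nat.one_le_iff_ne_zero.mpr (Nat.pos_iff_ne_zero.mp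
      (Nat.ceil_pos.mpr (by linarith)))
    exact_mod_cast this
  have hDc : (Dc : ℝ) ≤ 2 * (N : ℝ) ^ (1 / 2 - δ) := by
    have := (Nat.ceil_lt_add_one (by linarith : (0 : ℝ) ≤ (N : ℝ) ^ (1 / 2 - δ))).le
    linarith
  have hlogDc : Real.log Dc ≤ L := by
    have hsq : (N : ℝ) ^ (1 / 2 - δ) ≤ Real.sqrt N := by
      rw [Real.sqrt_eq_rpow]
      exact Real.rpow_le_rpow_of_exponent_le hN1 (by linarith)
    have h2 : 2 * Real.sqrt N ≤ N := by
      calc 2 * Real.sqrt N ≤ Real.sqrt N * Real.sqrt N :=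
            mul_le_mul_of_nonneg_right hs2 (Real.sqrt_nonneg N)
        _ = N := hsN
    exact Real.log_le_log (by linarith) (by linarith)
  set D₀ : ℕ := ⌊(L / 16) ^ 6⌋₊ with hD₀def
  have hL16 : 2 ≤ L / 16 := by rw [le_div_iff₀ (by norm_num)]; linarith
  have hpow6 : (2 : ℝ) ^ 6 ≤ (L / 16) ^ 6 := pow_le_pow_left₀ (by norm_num) hL16 6
  have hD₀hi : (D₀ : ℝ) ≤ (L / 16) ^ 6 := Nat.floor_le (by positivity)
  have hD₀lo : (L / 16) ^ 6 / 2 ≤ D₀ := by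
    have := (Nat.sub_one_lt_floor ((L / 16) ^ 6)).le
    have h64 : (64 : ℝ) ≤ (L / 16) ^ 6 := le_trans (by norm_num) hpow6
    linarith
  have hD₀1 : 1 ≤ D₀ := by
    have : (1 : ℝ) ≤ D₀ := by
      have h64 : (64 : ℝ) ≤ (L / 16) ^ 6 := le_trans (by norm_num) hpow6
      linarith
    exact_mod_cast this
  have hD₀Y : (D₀ : ℝ) ≤ (Real.log Y / 2) ^ ((20 : ℕ) : ℝ) := by
    rw [Real.rpow_natCast]
    have h1 : L / 16 ≤ Real.log Y / 2 := by linarith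
    have h1' : 1 ≤ L / 16 := by linarith
    calc (D₀ : ℝ) ≤ (L / 16) ^ 6 := hD₀hi
      _ ≤ (L / 16) ^ 20 := pow_le_pow_right₀ h1' (by norm_num)
      _ ≤ (Real.log Y / 2) ^ 20 := pow_le_pow_left₀ (by positivity) h1 20
  set W : ℝ := totientInvSum Dc with hWdef
  have hW0 : 0 ≤ W := totientInvSum_nonneg Dc
  have hW : W ≤ 4 * L ^ 2 := by
    calc W ≤ (1 + Real.log Dc) ^ 2 := totientInvSum_le Dc
      _ ≤ (2 * L) ^ 2 := by
          have : 0 ≤ 1 + Real.log Dc := by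
            have := Real.log_nonneg hDc1; linarith
          exact pow_le_pow_left₀ this (by linarith) 2
      _ = 4 * L ^ 2 := by ring
  -- the indicator coefficients
  set a : ℕ → ℂ := fun n => if n ∈ blockProducts N ε k then 1 else 0 with hadef
  have ha : ∀ n, ‖a n‖ ≤ 1 := fun n => by
    simp only [hadef]; split_ifs <;> simp
  -- Theorem 10.7 for the block
  have hB := Bilinear.primes_explicit (by norm_num : (0 : ℝ) < ((20 : ℕ) : ℝ)) hC₂0 hSW a ha
    (show N ≠ 0 by omega) M ⌈ℓ⌉₊ TY Dc hD₀1 hY9 hTY hD₀Y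
  simp only [Real.rpow_natCast] at hB
  rw [← hLdef, ← hTdef, ← hWdef] at hB
  -- the arithmetic
  have harith := blockBound_arith (L := L) (N := (N : ℝ)) (ℓ := ℓ) (Y := Y) (M := (M : ℝ))
    (T := T) (D := (Dc : ℝ)) (D₀ := (D₀ : ℝ)) (W := W) (C₂ := C₂) (δ := δ)
    hL hN1 hℓ1 hℓlo hℓhi hM0 hM hT0 hT hY9 hYℓ hlogY hlogY1 hDc1 hDc hlogDc hD₀lo hD₀hi hW hC₂0
    hev1 hev2
  -- the correction term `∑ ω(d) #M_k/φ(d) ≤ 16 L³ N/ℓ ≤ N/L⁴`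
  have hcard : (#(blockProducts N ε k) : ℝ) ≤ M := by
    have hsub : blockProducts N ε k ⊆ Finset.Ioc 0 M := by
      intro m hm
      obtain ⟨hm1, hmlt, -, -⟩ := blockProducts_props hNpos hε hm
      rw [Finset.mem_Ioc]
      refine ⟨hm1, ?_⟩
      have : m < M := Nat.lt_ceil.mpr hmlt
      omega
    calc (#(blockProducts N ε k) : ℝ) ≤ #(Finset.Ioc 0 M) := by exact_mod_cast Finset.card_le_card hsub
      _ = M := by simp
  have hcorr : ∑ d ∈ Finset.Icc 1 Dc,
      (d.primeFactors.card : ℝ) * #(blockProducts N ε k) / Nat.totient d ≤ N / L ^ 4 := by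
    have hstep : ∀ d ∈ Finset.Icc 1 Dc,
        (d.primeFactors.card : ℝ) * #(blockProducts N ε k) / Nat.totient d ≤
          (L / Real.log 2 * M) * ((Nat.totient d : ℝ))⁻¹ := by
      intro d hd
      obtain ⟨hd1, hdD⟩ := Finset.mem_Icc.mp hd
      have hφ : 0 < (Nat.totient d : ℝ) := by exact_mod_cast Nat.totient_pos.mpr hd1
      rw [div_eq_mul_inv]
      refine mul_le_mul_of_nonneg_right ?_ (inv_nonneg.mpr hφ.le)
      have hω : (d.primeFactors.card : ℝ) ≤ L / Real.log 2 := by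
        refine (card_primeFactors_le_log_div (show d ≠ 0 by omega)).trans ?_
        refine div_le_div_of_nonneg_right ?_ (Real.log_pos one_lt_two).le
        exact (Real.log_le_log (by exact_mod_cast hd1) (by exact_mod_cast hdD)).trans hlogDc
      exact mul_le_mul hω hcard (Nat.cast_nonneg _)
        (div_nonneg hL0.le (Real.log_pos one_lt_two).le)
    refine (Finset.sum_le_sum hstep).trans ?_
    rw [← Finset.mul_sum, ← totientInvSum]
    have hl2 : L / Real.log 2 ≤ 2 * L := by
      calc L / Real.log 2 = L * (1 / Real.log 2) := by ring
        _ ≤ L * 2 := mul_le_mul_of_nonneg_left inv_log_two_le_two hL0.le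
        _ = 2 * L := by ring
    have hsqrtℓ : (N : ℝ) ^ (1 / 16 : ℝ) ≤ Real.sqrt ℓ := by
      rw [show (1 / 16 : ℝ) = 1 / 8 * (1 / 2) by norm_num, Real.rpow_mul hN0.le,
        Real.sqrt_eq_rpow]
      exact Real.rpow_le_rpow (Real.rpow_nonneg hN0.le _) hℓlo (by norm_num)
    have hℓbig : 16 * L ^ 7 ≤ ℓ := by
      have hsqℓ_le : Real.sqrt ℓ ≤ ℓ := by
        have h1 : 1 ≤ Real.sqrt ℓ := by
          have := Real.sqrt_le_sqrt hℓ1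
          rwa [Real.sqrt_one] at this
        calc Real.sqrt ℓ = Real.sqrt ℓ * 1 := by ring
          _ ≤ Real.sqrt ℓ * Real.sqrt ℓ := mul_le_mul_of_nonneg_left h1 (Real.sqrt_nonneg ℓ)
          _ = ℓ := Real.mul_self_sqrt hℓ0.le
      have h32 : (32 : ℝ) ^ 11 ≤ L ^ 11 := pow_le_pow_left₀ (by norm_num) hL 11
      calc 16 * L ^ 7 ≤ L ^ 11 * L ^ 7 := by
            refine mul_le_mul_of_nonneg_right (le_trans (by norm_num) h32) (by positivity)
        _ = L ^ 18 := by ring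
        _ ≤ Real.sqrt ℓ := hev1.trans hsqrtℓ
        _ ≤ ℓ := hsqℓ_le
    calc L / Real.log 2 * M * totientInvSum Dc ≤ (2 * L) * (2 * N / ℓ) * (4 * L ^ 2) := by
          refine mul_le_mul (mul_le_mul hl2 hM hM0 (by positivity)) hW hW0 (by positivity)
      _ = 16 * L ^ 3 * N / ℓ := by ring
      _ ≤ N / L ^ 4 := by
          rw [div_le_div_iff₀ hℓ0 (by positivity)]
          calc 16 * L ^ 3 * N * L ^ 4 = (16 * L ^ 7) * N := by ring
            _ ≤ ℓ * N := mul_le_mul_of_nonneg_right hℓbig hN0.le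
            _ = N * ℓ := by ring
  -- assemble
  have hX0 : 0 ≤ (N : ℝ) / L ^ 4 := by positivity
  have htot : (3 * 10 ^ 9 + 3 * 10 ^ 8 * C₂) * N / L ^ 4 + N / L ^ 4 =
      (3 * 10 ^ 9 + 3 * 10 ^ 8 * C₂ + 1) * N / L ^ 4 := by ring
  rw [← htot]
  exact add_le_add (hB.trans harith) hcorr

/-- **(10.15) summed over the blocks**: for `0 < ε ≤ 1` and `0 < δ ≤ 1/4` there is `C` with
`R(N, ε, N^{1/2−δ}) ≤ C N/(log N)³` for all large `N` (Nathanson p. 289 and (10.15): each of the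
`O(ε⁻¹ log N)` pieces `B^{(ℓ)}` has `R^{(ℓ)} ≪ N/(log N)⁴` by Theorem 10.7 — Bombieri–Vinogradov
strength for the bilinear form `p₁ · (p₂p₃)` from the large sieve and the Siegel–Walfisz theorem,
both PROVED in the tree). Here `C = (3·10⁹ + 3·10⁸ C₂ + 1)(1/log(1+ε) + 1)` with the
Siegel–Walfisz constant `C₂` of exponent `20`. [cite: Nathanson1996, Thm 10.6 (proof, (10.15))] -/
theorem switchedRemainderExt_le {ε δ : ℝ} (hε : 0 < ε) (hε1 : ε ≤ 1) (hδ : 0 < δ)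
    (hδ1 : δ ≤ 1 / 4) :
    ∃ C : ℝ, ∀ᶠ N : ℕ in atTop,
      switchedRemainderExt N ε ((N : ℝ) ^ (1 / 2 - δ)) ≤ C * N / Real.log N ^ 3 := by
  classical
  obtain ⟨C₂, hC₂0, hSW⟩ := swBound_of_siegel_walfisz
    Literature.NumberTheory.LFunctions.siegel_walfisz_holds
    (A₂ := ((20 : ℕ) : ℝ)) (by norm_num)
  set C₁ : ℝ := 3 * 10 ^ 9 + 3 * 10 ^ 8 * C₂ + 1 with hC₁
  have hC₁0 : 0 ≤ C₁ := by positivity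
  have hlog1 : 0 < Real.log (1 + ε) := Real.log_pos (by linarith)
  refine ⟨C₁ * (1 / Real.log (1 + ε) + 1), ?_⟩
  -- the eventual conditions
  have hlog : Tendsto (fun N : ℕ => Real.log N) atTop atTop :=
    Real.tendsto_log_atTop.comp (tendsto_natCast_atTop_atTop (R := ℝ))
  have hev1 : ∀ᶠ N : ℕ in atTop, Real.log N ^ 18 ≤ (N : ℝ) ^ (1 / 16 : ℝ) := by
    have h := (eventually_log_rpow_le_rpow 18 (by norm_num : (0 : ℝ) < 1 / 16))
    filter_upwards [(tendsto_natCast_atTop_atTop (R := ℝ)).eventually h] with N hN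
    rwa [show (18 : ℝ) = ((18 : ℕ) : ℝ) by norm_num, Real.rpow_natCast] at hN
  have hev2 : ∀ᶠ N : ℕ in atTop, 128 * Real.log N ^ 6 ≤ (N : ℝ) ^ δ := by
    have h1 := (eventually_log_rpow_le_rpow 6 (by linarith : (0 : ℝ) < δ / 2))
    have h2 := (tendsto_rpow_atTop (by linarith : (0 : ℝ) < δ / 2)).eventually_ge_atTop 128
    filter_upwards [(tendsto_natCast_atTop_atTop (R := ℝ)).eventually h1,
      (tendsto_natCast_atTop_atTop (R := ℝ)).eventually h2, eventually_ge_atTop 1] with N hN hN' hN1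
    rw [show (6 : ℝ) = ((6 : ℕ) : ℝ) by norm_num, Real.rpow_natCast] at hN
    have hN0 : (0 : ℝ) < N := by exact_mod_cast hN1
    have hlog0 : 0 ≤ Real.log N ^ 6 := pow_nonneg (Real.log_natCast_nonneg N) 6
    calc 128 * Real.log N ^ 6 ≤ (N : ℝ) ^ (δ / 2) * (N : ℝ) ^ (δ / 2) :=
          mul_le_mul hN' hN hlog0 (by positivity)
      _ = (N : ℝ) ^ δ := by rw [← Real.rpow_add hN0]; ring_nf
  filter_upwards [eventually_ge_atTop (9 ^ 8), hlog.eventually_ge_atTop 32, hev1, hev2]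
    with N hN hL hev1N hev2N
  have hN2 : 2 ≤ N := le_trans (by norm_num) hN
  have hN3 : 3 ≤ N := le_trans (by norm_num) hN
  have hNpos : 0 < N := by omega
  have hN0 : (0 : ℝ) < N := by exact_mod_cast hNpos
  have hL0 : 0 < Real.log N := by linarith
  -- `R ≤ ∑_k (block sums) ≤ ∑_k C₁ N/L⁴`
  have hblocks := switchedRemainderExt_le_sum_blocks hN2 hε ((N : ℝ) ^ (1 / 2 - δ))
  refine hblocks.trans ?_
  have hper : ∀ k ∈ Finset.range (maxGridIndex N ε + 1),
      ∑ d ∈ (Finset.range ⌈(N : ℝ) ^ (1 / 2 - δ)⌉₊).filter (· ∣ primesProdBelow (y N)),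
          |(#((blockPrimes N ε k ×ˢ blockPairs N ε k).filter
              fun t : ℕ × ℕ × ℕ => d ∣ tripleDist N t) : ℝ) -
            shiftedPrimesDensity N d * #(blockPrimes N ε k ×ˢ blockPairs N ε k)| ≤
        C₁ * N / Real.log N ^ 4 := by
    intro k hk
    have hk' : k ≤ maxGridIndex N ε := Nat.lt_succ_iff.mp (Finset.mem_range.mp hk)
    have hsub : blockProducts N ε k ⊆ Finset.Ioc 0 ⌈(N : ℝ) / gridLevel N ε k⌉₊ := by
      intro m hm
      obtain ⟨hm1, hmlt, -, -⟩ := blockProducts_props hNpos hε hm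
      rw [Finset.mem_Ioc]
      refine ⟨hm1, ?_⟩
      have : m < ⌈(N : ℝ) / gridLevel N ε k⌉₊ := Nat.lt_ceil.mpr hmlt
      omega
    refine (blockRemainder_sum_le hNpos hε k _ hsub).trans ?_
    rw [hC₁]
    exact blockTotal_le hC₂0 hSW hε hε1 hδ hδ1 hN hL hev1N hev2N hk'
  calc _ ≤ ∑ _k ∈ Finset.range (maxGridIndex N ε + 1), C₁ * N / Real.log N ^ 4 :=
        Finset.sum_le_sum hper
    _ = ((maxGridIndex N ε : ℝ) + 1) * (C₁ * N / Real.log N ^ 4) := by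
        rw [Finset.sum_const, Finset.card_range, nsmul_eq_mul]; push_cast; ring
    _ ≤ ((1 / Real.log (1 + ε) + 1) * Real.log N) * (C₁ * N / Real.log N ^ 4) :=
        mul_le_mul_of_nonneg_right (maxGridIndex_add_one_le hN3 hε) (by positivity)
    _ = C₁ * (1 / Real.log (1 + ε) + 1) * N / Real.log N ^ 3 := by
        field_simp

end Literature.NumberTheory.Sieve.Chen
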